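import Literature.NumberTheory.EllipticCurves.GreenbergSelmer
import Literature.NumberTheory.EllipticCurves.OrdinaryLocalReductionMapProofs
import Literature.NumberTheory.EllipticCurves.SerreOpenImageOrdinaryInertiaProofs
import Literature.NumberTheory.EllipticCurves.KodairaNeronUnramifiedInertiaProofs
import Literature.NumberTheory.EllipticCurves.SelmerFiniteProofs
import Literature.NumberTheory.EllipticCurves.CyclotomicLineWeilPairingProofs
import Literature.NumberTheory.GaloisRepresentations.LocalKroneckerWeberInertiaProofs
import Literature.NumberTheory.EllipticCurves.PAdicBSDKatoFiniteProofs
import Literature.NumberTheory.EllipticCurves.GreenbergVatsal2000.GreenbergSelmerGroups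
import Literature.NumberTheory.EllipticCurves.KummerSelmerStructure
import Mathlib.RingTheory.RootsOfUnity.AlgebraicallyClosed
import Literature.NumberTheory.EllipticCurves.Rank1Residual.GVParityIsogenyConjugationProofs
import Literature.NumberTheory.EllipticCurves.Rank1Residual.ClassX1Isogeny
import Literature.NumberTheory.EllipticCurves.IsogenyQuotientCurveProofs
import Literature.NumberTheory.EllipticCurves.IsogenyVariableChangeProofs
import Literature.NumberTheory.EllipticCurves.IsogenyCompProofs
import Literature.NumberTheory.EllipticCurves.GlobalMinimalModelProofs
import Literature.NumberTheory.EllipticCurves.PastenHeightBoundsLemma68Proofs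
import Literature.NumberTheory.EllipticCurves.RootNumberTwistProofs
import Literature.NumberTheory.EllipticCurves.PAdicBSDSplitMultiplicativeProofs
import Literature.NumberTheory.EllipticCurves.ModularCurveManinSemistableBridgeProofs
import Literature.NumberTheory.EllipticCurves.KenkuMinimalLevels
import Literature.NumberTheory.EllipticCurves.IsogenyClassFiniteProofs
import Literature.NumberTheory.EllipticCurves.SupersingularIrreducibleProofs
import Literature.NumberTheory.EllipticCurves.ReducibleTorsionRibetLattice
import Literature.NumberTheory.GaloisRepresentations.DecompositionGroupOfCompletion
import HarnessLib

/-!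
# Ribet's lemma for `E/ℚ` at a good Eisenstein prime `p > 2` (Keller–Yin's good lattice EXISTS in every isogeny class) — `ribet_exists_isIsogenous_noUnramifiedLine` HOLDS (re-homed proofs)

**K. Ribet, *A modular construction of unramified p-extensions of ℚ(μ_p)*, Invent. Math. 34 (1976), Prop. (2.1) p. 154
[Ribet1976]; T. Keller, M. Yin, arXiv:2402.12781v2, Prop. 1.3.1 and §1.4 (the "good lattice" of an isogeny class at a good
Eisenstein prime) [KellerYin2024]; R. Greenberg, V. Vatsal, *On the Iwasawa invariants of elliptic curves*, Invent. Math. 142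
(2000) §2 [GreenbergVatsal2000]; J. Silverman, *AEC* (2009) Prop. III.4.12, Rem. III.4.13.2, Cor. IX.6.2 [SilvermanAEC2009];
G. Faltings, Invent. Math. 73 (1983) §5 [Faltings1983Endlichkeit] — the EXACT discharge
`Literature.NumberTheory.EllipticCurves.ribet_exists_isIsogenous_noUnramifiedLine_holds` of the Literature named fact of
`ReducibleTorsionRibetLattice.lean`, PROVED IN THE KERNEL by the elementary isogeny-graph argument: if `W` has an unramified
rational `p`-line `Φ`, the `Γ_ℚ`-stable CYCLIC subgroups `ℤx ⊂ E(ℚ̄)` of order `p^k` with `(ℤx)[p] = Φ` have bounded `k`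
(Shafarevich finiteness of the isogeny class), and the quotient of `W` by a maximal one is a globally minimal `W'` whose
rational `p`-lines are all ramified at `p` (the image of `E[p]` is the reduction line, ramified by the cyclotomic character on
the kernel of reduction at a good ordinary `p`; a second unramified line would extend the cyclic subgroup).**  RE-HOMED into
`Literature/` by the Hodge foundations lane (`lit-hodgefound`, prover p20, generation 39): verbatim DECLARATION-LEVEL port
of the 43 declarations (35 theorems, 8 definitions with bodies) that the discharge needs, out of the 13 Summits modules
`Summits/BirchSwinnertonDyer/Rank1Residual/{X2/GreenbergVatsalTorsion, X2/GreenbergVatsalReductionDatum,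
X2/GreenbergVatsalReductionDatumLine, X1/TamagawaSqueeze, X1/CongruenceTransfer, X2/GreenbergVatsalTateDatumCofree,
X2/TateLineDecomposition, X2/IsogenyLineType, X2/IsogenyQuotientLine, X2/GreenbergVatsalReductionDatumCard,
X2/IsogenyLineTypeGoodOrdinary, X1/StableCyclicQuotient, X1/GoodLatticeExists}.lean` (cell `bsd-eis`, seat `bsd-eis-ky`;
FULL-BSD rank-≤1 programme row A1), namespaces `Summit.BirchSwinnertonDyer.Rank1Residual.{X1,X2}.<Module>` re-rooted to
`Literature.NumberTheory.EllipticCurves.RibetGoodLattice.<Module>`; imports from `Literature/` and Mathlib only; no `sorry`,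
no new axiom, no new named fact (D-0026).  One `section PartK` per source module, in dependency order; every declaration keeps
its source docstring and carries a `[cite: …]` locator (the Part's default where the source had none).

WHAT THIS IS NOT: not Ribet's lattice argument itself (Prop. 2.1 for general `G`, `𝔬`); only `E/ℚ`, `Γ_ℚ`, `ℤ_p`, one
ordering of the characters — exactly the tree's named fact; nothing about BSD.
-/

noncomputable section

/-!
## Part 1 — port of `Summits/BirchSwinnertonDyer/Rank1Residual/X2/GreenbergVatsalTorsion.lean` (2 declarations kept)

# Greenberg–Vatsal 2000, Prop. (2.8) WITHOUT `H⁰(ℚ, A[π]) = 0`: the non-primitive Greenberg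
# Selmer group of `M[n]` over `L = K̄^H` (e.g. `K_∞`) versus `S^{Σ₀}_M(L)[n]`, kernel `M(L)/n`

WHAT THIS FILE PROVES (referee R98.2 option (β), flag `GV-Prop28-H0-remark`). Greenberg–Vatsal,
Invent. Math. 142 (2000) = arXiv:math/9906215, §2: for `Σ ∋ p, ∞` finite, `Σ₀ = Σ − {p, ∞}`, the
NON-PRIMITIVE Greenberg Selmer group `S^{Σ₀}_A(ℚ_∞) = ker (H¹(ℚ_Σ/ℚ_∞, A) → 𝓗_p × 𝓗_∞)`
(pp. 16–17, 23), `𝓗_p = H¹((ℚ_∞)_𝔭, A)/ker(→ H¹(I_𝔭, D))`, `D = A/C`; (p. 25) `S^{Σ₀}_{A[π]}(ℚ_∞)`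
"entirely analogous" with `𝓗_ℓ(ℚ_∞, A[π]) = ∏_{η∣ℓ} H¹(I_η, A[π])` (`ℓ ≠ p`), `𝓗_p = H¹(I_p, D[π])`;
**Prop. (2.8)**: "Let `p` be an odd prime. Assume that `Σ₀ ⊆ Σ − {p, ∞}` contains `Ram(A)`.
Assume that `I_p` acts trivially on `D` and that `H⁰(ℚ, A[π]) = 0`. Then
`S^{Σ₀}_A(ℚ_∞)[π] ≅ S^{Σ₀}_{A[π]}(ℚ_∞)`" — proved via `H¹(ℚ_Σ/ℚ_∞, A[π]) → H¹(ℚ_Σ/ℚ_∞, A)[π]`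
("an isomorphism" under `H⁰ = 0`) and "`H¹(I_η, A[π]) → H¹(I_η, A)` is injective because
`H⁰(I_η, A) = A` is divisible … `H¹(I_p, D[π]) → H¹(I_p, D)` is injective because `H⁰(I_p, D) = D`".
HERE, for ANY number field `K`, normal `H ≤ Γ_K` (fixed field `L`; `H = ker κ` for `L = K_∞`),
discrete `Γ_K`-module `M` with continuous orbit maps, `n`-divisible, Greenberg data `(M⁺_v)_{v∣p}`
with `I_v` TRIVIAL ON `M/M⁺_v`, `M` UNRAMIFIED at the finite `v ∉ Σ₀`, `v ∤ p` — and with NO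
hypothesis on `M^H = H⁰(L, M)` (for `M = E[p^∞]`, `L = ℚ_∞`: `M^H = E(ℚ_∞)[p^∞]`):
* `gvSelmer H M p L S₀ = S^{Σ₀}_M(L)` (`Σ₀ = S₀`): classes in `H¹(H, M)` which, conjugated by every
  `σ ∈ Γ_K` (= at every place of `L` above `v`), are UNRAMIFIED at each finite `v ∉ Σ₀`, `v ∤ p`
  (die in `H¹(H ⊓ I_v, M)`) and satisfy Greenberg's condition at each `v ∣ p` (die in
  `H¹(H ⊓ I_v, M/M⁺_v)`) — GV's group with `Σ := Σ₀ ∪ {p, ∞}`, "unramified outside `Σ`" spelled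
  place by place through the inertia groups of the tree's `GreenbergSelmer`, WITHOUT the
  archimedean factor `𝓗_∞` (vacuous for odd `p` and `p`-primary `M`; GV assume `p` odd); it
  contains the tree's primitive `GreenbergSelmer.selmerGroupOver` (`selmerGroupOver_le_gvSelmer`);
* `torsionData L n` — the induced data `M[n] ∩ M⁺_v` (GV: `C[π] ⊂ A[π]`), graded piece injecting
  `I_v`-equivariantly into `M/M⁺_v` (`grIncl`, GV's `D[π] ⊂ D`): `S^{Σ₀}_{M[n]}(L)` is the SAME
  construction on the Galois module `M[n]` (GV p. 26);
* **`mem_gvSelmer_torsion_iff`**: `c ∈ S^{Σ₀}_{M[n]}(L) ↔ α c ∈ S^{Σ₀}_M(L)`, `α = ι_*`;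
* **`gvSelmerQuotientKerEquiv`**: `S^{Σ₀}_{M[n]}(L)/ker α ≃ S^{Σ₀}_M(L) ⊓ H¹(H, M)[n]`, with
  `ker α ≃ M^H/n·M^H` (`TorsionComparison.kerEquiv`): the exact sequence
  **`0 → M^H/n → S^{Σ₀}_{M[n]}(L) → S^{Σ₀}_M(L)[n] → 0`**;
* **`natCard_gvSelmer_torsion(_of_finite)`**: `#S^{Σ₀}_{M[n]}(L) = #S^{Σ₀}_M(L)[n] · #(M^H/n·M^H)`
  (`= … · #M^H[n]` for finite `M^H`) — for `n = p`, `M = E[p^∞]`, in `𝔽_p`-dimensions: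
  **`dim S^{Σ₀}_{E[p]} = dim S^{Σ₀}_{E[p^∞]}[p] + dim E(L)[p]`**, the remark of X1R0-GAPMAP §16.0 /
  ROUTE-G-REMARK-PROOF Claim R on which the `φ = 1` route-G closures rest;
* **`gvSelmerAlpha_bijective_of_noTorsionInvariants`**: Prop. (2.8) AS PRINTED (finite `M^H` with
  `M^H[n] = 0`, e.g. `H⁰(ℚ_∞, A) = 0`): `α : S^{Σ₀}_{M[n]}(L) ≃ S^{Σ₀}_M(L)[n]`;
* `gvSelmerInfty κ` — the `ℤ_p`-extension spelling (`H = ker κ`).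
NOT HERE (printed / typed elsewhere): the second half of Prop. (2.8) (`μ = 0 ⟺` finiteness,
`λ = dim`, via Prop. (2.5)), Cor. (2.3)/Prop. (2.4) (`λ^{Σ₀} = λ + Σ δ_ℓ`), `S_A = Sel_E(ℚ_∞)_p`
(Greenberg 1999), the trivial zero at `p ‖ N`, the archimedean factor.

References: Greenberg–Vatsal, Invent. Math. 142 (2000) 17–63 = arXiv:math/9906215, §2 pp. 16–17,
23, 25–26; Greenberg, Adv. Stud. Pure Math. 17 (1989), p. 98; Greenberg, LNM 1716 (1999), p. 149
(the comparison "for good, ordinary or multiplicative reduction at `p`", stated without `H⁰ = 0`).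
-/

section Part1

open scoped _root_.Classical AddSubgroup

open _root_.NumberField _root_.IsDedekindDomain _root_.Field
open Literature.NumberTheory.EllipticCurves Literature.NumberTheory.EllipticCurves.GreenbergSelmer
  Literature.NumberTheory.GaloisRepresentations

universe u

namespace Literature.NumberTheory.EllipticCurves.RibetGoodLattice.GreenbergVatsalTorsion

variable {K : Type u} [Field K] [NumberField K]

/-! ## §1. The non-primitive Greenberg Selmer group `S^{S₀}_M(L)` (finite places) -/

section Defs

variable (H : Subgroup (absoluteGaloisGroup K)) (M : Type u) [AddCommGroup M]
  [DistribMulAction (absoluteGaloisGroup K) M] [TopologicalSpace M] [DiscreteTopology M]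

variable [H.Normal] (p : ℕ) (L : Data K M p) (S₀ : Set (HeightOneSpectrum (𝓞 K)))

end Defs

/-! ## §2. The induced Greenberg data on `M[n]` and the injection `M[n]/(M[n] ∩ M⁺) ↪ M/M⁺` -/

section TorsionData

variable {M : Type u} [AddCommGroup M] [DistribMulAction (absoluteGaloisGroup K) M] {p : ℕ}

/-- **The induced local datum `M[n] ∩ M⁺_v` on the `n`-torsion** (GV p. 25: "Consider the exact
sequence `0 → C[π] → A[π] → D[π] → 0`"). [cite: GreenbergVatsal2000, §2 p. 25] -/
def torsionDatum {v : HeightOneSpectrum (𝓞 K)} (N : LocalDatum K M v) (n : ℕ) :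
    LocalDatum K (M[(n : ℤ)]) v where
  plus := N.plus.addSubgroupOf (M[(n : ℤ)])
  smul_mem σ {m} hm := by
    rw [AddSubgroup.mem_addSubgroupOf] at hm ⊢
    exact N.smul_mem σ hm

/-- The induced Greenberg data `(M[n] ∩ M⁺_v)_{v ∣ p}` on `M[n]`.
[cite: GreenbergVatsal2000, §2 p. 25] -/
def torsionData (L : Data K M p) (n : ℕ) : Data K (M[(n : ℤ)]) p :=
  fun v hv ↦ torsionDatum (L v hv) n

end TorsionData

/-! ## §3. Local conditions correspond under `α`; the comparison theorems -/

section Main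

variable (H : Subgroup (absoluteGaloisGroup K)) [H.Normal] (M : Type u) [AddCommGroup M]
  [DistribMulAction (absoluteGaloisGroup K) M] [TopologicalSpace M] [DiscreteTopology M]
  (p : ℕ) (L : Data K M p) (S₀ : Set (HeightOneSpectrum (𝓞 K))) (n : ℕ)

end Main

/-! ## §4. Over a `ℤ_p`-extension `K_∞ = K̄^{ker κ}` -/

section Tower

variable {p : ℕ} [Fact p.Prime] (κ : ZpExtension K p) (M : Type u) [AddCommGroup M]
  [DistribMulAction (absoluteGaloisGroup K) M] [TopologicalSpace M] [DiscreteTopology M]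
  (L : Data K M p) (S₀ : Set (HeightOneSpectrum (𝓞 K)))

end Tower

end Literature.NumberTheory.EllipticCurves.RibetGoodLattice.GreenbergVatsalTorsion

end Part1

/-!
## Part 2 — port of `Summits/BirchSwinnertonDyer/Rank1Residual/X2/GreenbergVatsalReductionDatum.lean` (12 declarations kept)

# Greenberg's datum `C_p = ker(E[p^∞] → Ẽ(𝔽̄_p))` of a good prime of `E/ℚ`, IN THE KERNEL:
# `D_p`-stability, GV's hypothesis "`I_p` acts trivially on `D`" and the Kummer compatibility
# DISCHARGED from the tree's reduction map; hence `Sel_{p^∞}(E/ℚ_∞) ⊆ S^{Σ₀}_{E[p^∞]}(ℚ_∞)` and the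
# `E(ℚ)[p]`-corrected comparison with NO hypothesis on the datum

GREENBERG–VATSAL p. 26 (arXiv:math/9906215; Invent. Math. 142 (2000)): "Assume that `E` has good
ordinary reduction at `p`. Then viewing `A` as a `G_{ℚ_p}`-module, we define
`C = ker(E[p^∞] → Ẽ[p^∞])`, where `Ẽ` is the reduction of `E` modulo `p`. Then `D = Ẽ[p^∞]` is
unramified as a `G_{ℚ_p}`-module … In [Gre99], one can find a proof that `im(κ_p) = L_p`. This result,
together with the fact that `im(κ_η) = 0` for all primes `η` of `ℚ_∞` not lying over `p`, implies
that `Sel_E(ℚ_∞)_p = S_A(ℚ_∞)`. The nonprimitive Selmer groups `Sel^{Σ₀}_E(ℚ_∞)_p` and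
`S^{Σ₀}_A(ℚ_∞)` also coincide". THIS FILE builds that `C` for a globally minimal `E/ℚ` at a prime
`p ∤ Δ_E` as a `GreenbergSelmer.LocalDatum` on `E[p^∞] = W.geomPrimaryTorsion p`, from the tree's
reduction homomorphism `E(K̄_v) → Ẽ(k̄_v)` of the minimal model over the valuation ring of the
spectral valuation of `K̄_v` (`goodReductionHom`, `localIntModel_baseChange`,
`OrdinaryLocalReductionMapProofs` — Silverman VII.2.1), and PROVES:
* `localRed_smul_of_mem_absInertia` — the local inertia group does not change reductions
  (`reducePoint_congrEquiv_smul_eq_of_val` + `mem_inertia_iff_spectralValuation` +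
  `inertia_eq_absInertia`): "`D = Ẽ[p^∞]` is unramified";
* `reductionDatum` — `C_v = E[p^∞] ∩ ker red_v` is `D_v`-stable (`localRed_smul_eq_zero_iff`);
* **`reductionDatum_htriv`** — GV's hypothesis "`I_p` acts trivially on `D`" (the `htriv` of every
  gen-8 comparison theorem `GreenbergVatsalTorsion*.natCard_gvSelmer_torsion*`) HOLDS for `C_v`;
* **`reductionDatum_kummer`** — the Kummer compatibility of `GreenbergVatsalSelmerLink` (`σP - P`
  torsion, `σ ∈ I_{ℚ_v}`, `P ∈ E(K̄_v)` ⟹ `σP - P ∈ C_v`: `red(σP) = red(P)`) HOLDS for `C_v` —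
  Greenberg's `im(κ_p) ⊆ L_p` in the direction needed for an inclusion;
* **`selmerInfty_le_gvSelmerInfty_reductionData`** — `Sel_{p^∞}(E/ℚ_∞) ⊆ S^{Σ₀}_{E[p^∞]}(ℚ_∞)`
  (GV (6)) with NO hypothesis on the datum, for every `ℤ_p`-extension and every `Σ₀ ⊇` bad primes:
  referee R102.2 (b) (`gvSelmer-SelmerDualData-link`) — the Selmer group whose Pontryagin dual is
  `SelmerDualData.X` (route G's `D.X`) sits inside the object of the kernel comparison;
* **`natCard_gvSelmerInfty_torsion_reductionData`** — gen 8's `E(ℚ)[p]`-corrected GV Prop. (2.8)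
  `#S^{Σ₀}_{E[p]}(ℚ_∞) = #S^{Σ₀}_{E[p^∞]}(ℚ_∞)[p] · #E(ℚ_∞)[p^∞][p]` for Greenberg's datum at an odd
  good ordinary `p`, `κ` cyclotomic, now with NO hypothesis on the datum at all.
On `Σ₀ ⊇ Ram(E[p^∞])` (GV Prop. (2.5), referee R102.2 (a)): the standing hypothesis `hS` ("every
finite `v ∉ Σ₀` with `v ∤ p` is good") gives `Ram(E[p^∞]) ∖ {p} ⊆ Σ₀` by Silverman VII.4.1(a), in
the kernel as `GreenbergVatsalTorsionCurve.unramified_outside`; route G takes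
`Σ₀ = {ℓ ∣ N₁N₂, ℓ ≠ p}`.
WHAT STAYS PRINTED: `im(κ_p) = L_p` with EQUALITY (Greenberg LNM 1716 Props. 2.1–2.4), GV Cor. (2.3),
Prop. (2.4), Prop. (2.5) ("Let `p` be an odd prime. Assume that `S_A(ℚ_∞)` is `Λ`-cotorsion and
that `D` is unramified for the action of `G_{ℚ_p}`. Suppose that `Σ₀` is a subset of `Σ − {p, ∞}`
which contains `Ram(A)`. Then `S^{Σ₀}_A(ℚ_∞)^` has no nonzero, finite `Λ`-submodules." — p. 23; NO
`H⁰`/torsion clause) and the multiplicative-prime datum (Tate curve, GV pp. 14–15).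

References: Greenberg–Vatsal 2000, §2 pp. 14, 19, 23, 25–26; Greenberg, LNM 1716 (1999), §1 p. 62,
§2 pp. 69–75; Silverman, *AEC* 2nd ed., VII.2.1, VII.4.1; Neukirch, *ANT* II (4.8), (9.3).
-/

section Part2

open scoped _root_.Classical AddSubgroup _root_.NNReal

open _root_.NumberField _root_.IsDedekindDomain _root_.Field
open Literature.NumberTheory.EllipticCurves Literature.NumberTheory.EllipticCurves.GreenbergSelmer
  Literature.NumberTheory.GaloisRepresentations _root_.IsDedekindDomain.HeightOneSpectrum
  Literature.NumberTheory.EllipticCurves.RibetGoodLattice.GreenbergVatsalTorsion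
open _root_.WeierstrassCurve (minimalDiscriminantInt integralModelInt)

universe u

namespace Literature.NumberTheory.EllipticCurves.RibetGoodLattice.GreenbergVatsalReductionDatum

/-! ## §1. The spectral valuation `|·|_v` on `K̄_v`, chosen once -/

section SpecVal

variable {K : Type u} [Field K] [NumberField K] (v : HeightOneSpectrum (𝓞 K))

/-- **The spectral valuation `|·|_v` on `K̄_v`** (a choice from the tree's
`exists_spectralValuation`; the choice is immaterial: its values are the spectral norm,
`specVal_spec`). [cite: NeukirchANT1999, Ch. II Thm. (4.8)] -/
def specVal : Valuation (AlgebraicClosure (v.adicCompletion K)) ℝ≥0 :=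
  v.exists_spectralValuation.choose

/-- `specVal v` computes the spectral norm. [cite: NeukirchANT1999, Ch. II Thm. (4.8)] -/
theorem specVal_spec : ∀ x : AlgebraicClosure (v.adicCompletion K),
    (specVal v x : ℝ) = spectralNorm (v.adicCompletion K) (AlgebraicClosure (v.adicCompletion K)) x :=
  v.exists_spectralValuation.choose_spec

end SpecVal

/-! ## §2. The reduction map `E(K̄_v) → Ẽ(k̄_v)` of a globally minimal `E/ℚ` at a good prime -/

section Red

variable (W : WeierstrassCurve ℚ) [W.IsGloballyMinimal] (p : ℕ) [Fact p.Prime]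
  {v : HeightOneSpectrum (𝓞 ℚ)}

/-- **The reduction map `red_v : E(K̄_v) →+ Ẽ(k̄_v)`** at the place `v ∋ p` of a globally minimal
`E/ℚ` with `p ∤ Δ_E`: the good-reduction homomorphism (`goodReductionHom`, Silverman VII.2.1) of the
minimal model `W_ℤ ⊗ 𝒪_w` over the valuation ring `𝒪_w` of `|·|_v` on `K̄_v`, transported along
`W_ℤ ⊗ K̄_v = E ⊗ K̄_v` (`localIntModel_baseChange`) — the map `red₀` of the tree's
`OrdinaryLocalReductionMapProofs` / `SelmerCorankControlRatOrdinaryProofs`, packaged as a definition.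
[cite: SilvermanAEC2009, Prop. VII.2.1] -/
def localRed (hpv : ((p : ℕ) : 𝓞 ℚ) ∈ v.asIdeal) (hΔ : ¬ (p : ℤ) ∣ minimalDiscriminantInt W) :
    localPoints W (v.adicCompletion ℚ) →+
      (((integralModelInt W).map (algebraMap ℤ ↥(specVal v).valuationSubring)).map
        (IsLocalRing.residue ↥(specVal v).valuationSubring)).toAffine.Point :=
  (goodReductionHom _ (Valuation.valuationSubring.integers (specVal v))
      (W.isUnit_Δ_localIntModel hpv (specVal_spec v) hΔ)).comp
    (WeierstrassCurve.Affine.Point.congrEquiv (W.localIntModel_baseChange (specVal v).valuationSubring).symm).toAddMonoidHom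

/-- `red_v P` is the tree's `reducePoint` of the transported point (the shape `hred₀` of
`OrdinaryLocalReductionMapProofs`). [cite: SilvermanAEC2009, Prop. VII.2.1] -/
theorem localRed_apply (hpv : ((p : ℕ) : 𝓞 ℚ) ∈ v.asIdeal) (hΔ : ¬ (p : ℤ) ∣ minimalDiscriminantInt W)
    (P : localPoints W (v.adicCompletion ℚ)) :
    localRed W p hpv hΔ P =
      ((integralModelInt W).map (algebraMap ℤ ↥(specVal v).valuationSubring)).reducePoint
        (WeierstrassCurve.Affine.Point.congrEquiv (W.localIntModel_baseChange (specVal v).valuationSubring).symm P) :=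
  rfl

/-- **`ker red_v` is `Γ_{ℚ_v}`-stable**: `red_v (σQ) = 0 ↔ red_v Q = 0` (tree:
`localRed_smul_eq_zero_iff`). [cite: SilvermanAEC2009, VII.§2] -/
theorem localRed_smul_eq_zero_iff (hpv : ((p : ℕ) : 𝓞 ℚ) ∈ v.asIdeal)
    (hΔ : ¬ (p : ℤ) ∣ minimalDiscriminantInt W) (σ : absoluteGaloisGroup (v.adicCompletion ℚ))
    (Q : localPoints W (v.adicCompletion ℚ)) :
    localRed W p hpv hΔ (σ • Q) = 0 ↔ localRed W p hpv hΔ Q = 0 :=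
  W.localRed_smul_eq_zero_iff (specVal_spec v) (W.isUnit_Δ_localIntModel hpv (specVal_spec v) hΔ)
    (localRed W p hpv hΔ) (fun _ ↦ rfl) σ Q

/-- **The local INERTIA group does not change the reduction: `red_v (σQ) = red_v Q` for
`σ ∈ I_{ℚ_v}`** (`σ` moves `𝒪_w`-integers within `𝔪_w` — `mem_inertia_iff_spectralValuation` with
`I_𝔐 = absInertia`, `inertia_eq_absInertia` — so the integral coordinates of `Q` have the same
residues, `reducePoint_congrEquiv_smul_eq_of_val`). This is "the inertia group acts trivially on
`Ẽ(k̄_v)`", i.e. on Greenberg's `D`. [cite: SilvermanAEC2009, VII.§2 and VII.4.1] -/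
theorem localRed_smul_of_mem_absInertia (hpv : ((p : ℕ) : 𝓞 ℚ) ∈ v.asIdeal)
    (hΔ : ¬ (p : ℤ) ∣ minimalDiscriminantInt W) {σ : absoluteGaloisGroup (v.adicCompletion ℚ)}
    (hσ : σ ∈ absInertia (v.adicCompletion ℚ)) (Q : localPoints W (v.adicCompletion ℚ)) :
    localRed W p hpv hΔ (σ • Q) = localRed W p hpv hΔ Q := by
  obtain ⟨𝔐, h𝔐⟩ := v.localPrimesAbove_nonempty
  have hσ' : σ ∈ 𝔐.inertia (absoluteGaloisGroup (v.adicCompletion ℚ)) := by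
    rw [inertia_eq_absInertia (specVal_spec v) h𝔐]; exact hσ
  have hmove := (mem_inertia_iff_spectralValuation (specVal_spec v) h𝔐).1 hσ'
  rw [localRed_apply, localRed_apply]
  exact reducePoint_congrEquiv_smul_eq_of_val (specVal_spec v) (W.localIntModel_baseChange _) σ Q
    (fun x y _ _ ↦ ⟨hmove x, hmove y⟩)

omit [W.IsGloballyMinimal] [Fact p.Prime] in
/-- `E(K̄) → E(K̄_v)` intertwines `res σ ∈ D_v` with `σ ∈ Γ_{ℚ_v}` (`pointsMap_smul`, with the tree's
two names `resGal = absGaloisRestrict` for the same restriction). [cite: GreenbergVatsal2000, §2 p. 19, (6) and Prop. (2.8) (the reduction datum at p: good ordinary reduction map, trivial inertia on the reduction)] -/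
theorem pointsMap_absGaloisRestrict_smul {K : Type u} [Field K] (V : WeierstrassCurve K)
    (E : Type u) [Field E] [Algebra K E] (σ : absoluteGaloisGroup E) (P : V.geomPoints) :
    pointsMap V E (absGaloisRestrict K E σ • P) = σ • pointsMap V E P :=
  pointsMap_smul V E σ P

/-! ## §3. Greenberg's datum `C_v = E[p^∞] ∩ ker red_v` -/

/-- **Greenberg's ordinary datum at a good prime `v ∋ p` of `E/ℚ`: `C_v = ker (E[p^∞] → Ẽ(k̄_v))`**,
the `p`-power torsion of the kernel of reduction `E₁` (= of the formal group; at a good ORDINARY `p`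
this is Greenberg's `ℱ[p^∞] ≅ ℚ_p/ℤ_p`, LNM 1716 §1 p. 62, §2 p. 70: `0 → ℱ[p^∞] → E[p^∞] → Ẽ[p^∞] → 0`;
Greenberg–Vatsal's `C` with `D = A/C = Ẽ[p^∞]`, p. 14), as a `LocalDatum` of the tree's
`GreenbergSelmer`: `D_v`-stable because `ker red_v` is `Γ_{ℚ_v}`-stable.
[cite: GreenbergLNM1716, §1 p. 62 and §2 p. 70] [cite: GreenbergVatsal2000, §2 p. 14] -/
def reductionDatum (hpv : ((p : ℕ) : 𝓞 ℚ) ∈ v.asIdeal) (hΔ : ¬ (p : ℤ) ∣ minimalDiscriminantInt W) :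
    LocalDatum ℚ (W.geomPrimaryTorsion p) v where
  plus := ((localRed W p hpv hΔ).comp
    ((pointsMap W (v.adicCompletion ℚ)).comp (W.geomPrimaryTorsion p).subtype)).ker
  smul_mem σ {m} hm := by
    rw [AddMonoidHom.mem_ker, AddMonoidHom.comp_apply, AddMonoidHom.comp_apply,
      AddSubgroup.coe_subtype] at hm ⊢
    rw [primaryComponent.coe_smul, pointsMap_absGaloisRestrict_smul, localRed_smul_eq_zero_iff]
    exact hm

/-- Membership in `C_v`: `m ∈ C_v ↔ red_v (ι m) = 0`. [cite: GreenbergLNM1716, §2 p. 70] -/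
theorem mem_reductionDatum_plus_iff (hpv : ((p : ℕ) : 𝓞 ℚ) ∈ v.asIdeal)
    (hΔ : ¬ (p : ℤ) ∣ minimalDiscriminantInt W) (m : W.geomPrimaryTorsion p) :
    m ∈ (reductionDatum W p hpv hΔ).plus ↔
      localRed W p hpv hΔ (pointsMap W (v.adicCompletion ℚ) (m : W.geomPoints)) = 0 :=
  Iff.rfl

/-- **GV's hypothesis "`I_p` acts trivially on `D`" HOLDS for Greenberg's datum** (`htriv` of
`GreenbergVatsalTorsion.natCard_gvSelmer_torsion*`): for `x ∈ I_v` and `m ∈ E[p^∞]`,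
`x•m - m ∈ C_v`, because the local inertia group does not change reductions
(`localRed_smul_of_mem_absInertia`). GV p. 14 (good ordinary: "`D = Ẽ[p^∞]` … unramified"),
p. 26 ("assume that `I_p` acts trivially on `D`"). [cite: GreenbergVatsal2000, §2 p. 14 and Prop. (2.8)] -/
theorem reductionDatum_htriv (hpv : ((p : ℕ) : 𝓞 ℚ) ∈ v.asIdeal)
    (hΔ : ¬ (p : ℤ) ∣ minimalDiscriminantInt W) :
    ∀ x ∈ inertia v, ∀ m : W.geomPrimaryTorsion p, x • m - m ∈ (reductionDatum W p hpv hΔ).plus := by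
  intro x hx m
  obtain ⟨σ, hσ, rfl⟩ := Subgroup.mem_map.1 hx
  rw [mem_reductionDatum_plus_iff, AddSubgroupClass.coe_sub, primaryComponent.coe_smul, map_sub]
  change localRed W p hpv hΔ (pointsMap W (v.adicCompletion ℚ)
    (absGaloisRestrict ℚ (v.adicCompletion ℚ) σ • (m : W.geomPoints)) - _) = 0
  rw [pointsMap_absGaloisRestrict_smul, map_sub, localRed_smul_of_mem_absInertia W p hpv hΔ hσ,
    sub_self]

/-- **Greenberg's data above `p`** for a globally minimal `E/ℚ` with `p ∤ Δ_E` (one place `v ∋ p`).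
[cite: GreenbergLNM1716, §2 p. 70] -/
def reductionData (hΔ : ¬ (p : ℤ) ∣ minimalDiscriminantInt W) : Data ℚ (W.geomPrimaryTorsion p) p :=
  fun _ hv ↦ reductionDatum W p hv hΔ

/-- `htriv` for the data. [cite: GreenbergVatsal2000, §2 Prop. (2.8)] -/
theorem reductionData_htriv (hΔ : ¬ (p : ℤ) ∣ minimalDiscriminantInt W) :
    ∀ (v : HeightOneSpectrum (𝓞 ℚ)) (hv : ((p : ℕ) : 𝓞 ℚ) ∈ v.asIdeal),
      ∀ x ∈ inertia v, ∀ m : W.geomPrimaryTorsion p, x • m - m ∈ (reductionData W p hΔ v hv).plus :=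
  fun _ hv ↦ reductionDatum_htriv W p hv hΔ

end Red

/-! ## §4. The comparison theorem of gen 8 with `htriv` DISCHARGED -/

section Card

variable (W : WeierstrassCurve ℚ) [W.IsElliptic] [W.IsGloballyMinimal] {p : ℕ} [Fact p.Prime]
  (κ : ZpExtension ℚ p) (S₀ : Set (HeightOneSpectrum (𝓞 ℚ)))

end Card

/-! ## §5. The link, UNCONDITIONALLY, over `ℚ`: `Sel_{p^∞}(E/ℚ_∞) ⊆ S^{Σ₀}_{E[p^∞]}(ℚ_∞)` for
Greenberg's own datum -/

section Link

variable (W : WeierstrassCurve ℚ) [W.IsElliptic] [W.IsGloballyMinimal] (p : ℕ) [Fact p.Prime]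
  (S₀ : Set (HeightOneSpectrum (𝓞 ℚ)))

end Link

end Literature.NumberTheory.EllipticCurves.RibetGoodLattice.GreenbergVatsalReductionDatum

end Part2

/-!
## Part 3 — port of `Summits/BirchSwinnertonDyer/Rank1Residual/X2/GreenbergVatsalReductionDatumLine.lean` (2 declarations kept)

# `C[p] ≅ μ_p` for Greenberg's datum at an odd good ordinary prime of `E/ℚ`, IN THE KERNEL: the
# inertia group MOVES every point of `C[p]` (the hypothesis `hgen` of the intrinsic Greenberg–Vatsal
# transfer) — from the Weil pairing and `χ_p(I_{ℚ_p}) = ℤ_p^×`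

GREENBERG–VATSAL p. 26 (arXiv:math/9906215): "By the Weil pairing, one sees that the inertia group
`I_p` acts on `C` by the `p`-cyclotomic character. That is, `C ≅ μ_{p^∞}` as an `I_p`-module … since
we are assuming that `p` is odd, the subgroup `C[p]` of `A[p]` is determined by the action of `I_p`:
`C[p] = μ_p` and `D[p]` is the maximal quotient of `A[p]` on which `I_p` acts trivially." The
intrinsic transfer of gens 8–9 (`GreenbergVatsalTorsionLine.natCard_gvSelmer_inf_torsion_mul_eq_of_inertia`,
`GreenbergVatsalTorsionInvariants.natCard_gvSelmer_inf_torsion_eq_of_inertia`) encodes this as the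
per-module hypothesis `hgen`: "every `c ∈ C[p]` is `τ•c' − c'` for some `τ ∈ I_v`, `c' ∈ C[p]`".
THIS FILE PROVES `hgen` for Greenberg's own datum `reductionData` (`GreenbergVatsalReductionDatum`)
of a globally minimal `E/ℚ` at an ODD prime `p ∤ Δ_E` of ORDINARY reduction (`p ∤ a_p`):
* `exists_generator_and_inertia_smul_eq_two` — a generator `P₁` of the line
  `ker red_v ∩ E(K̄_v)[p]` (the tree's ordinary filtration `localRed_ordinary_filtration`, Greenberg
  LNM 1716 p. 62) and `σ₀` in the local inertia group with `σ₀P₁ = 2P₁`: inertia acts on the line by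
  scalars `c(σ)` and trivially on `E(K̄_v)[p]/ℤP₁` (`localRed_smul_of_mem_absInertia`), so the WEIL
  PAIRING (tree theorem `localPoints_exists_isPrimitiveRoot_smul_eq_pow`, Silverman III.8.1 —
  `det ρ̄ = χ̄`) yields a primitive `p`-th root of unity `ζ` with `σζ = ζ^{c(σ)}` on inertia
  (`C[p] ≅ μ_p`), and `χ_p(I_{ℚ_v}) = ℤ_p^×` (tree theorem
  `adicCompletion_rat_exists_mem_absInertia_cyclotomicCharacter_eq`, local Kronecker–Weber /
  Serre *Local Fields* IV §4 Prop. 17) supplies `σ₀` with `χ_p(σ₀) = 2`, whence `c(σ₀) ≡ 2 (mod p)`;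
* **`reductionData_hgen`** — `hgen` for `reductionData W p hΔ`: take `τ = res σ₀`, `c' = c`.
With `GreenbergVatsalReductionDatum` (`htriv`, Kummer) and `GreenbergVatsalTorsionCurve` (`hM`,
`hdiv`, `hunr`, finiteness of `E(ℚ_∞)[p^∞]`) EVERY hypothesis of the intrinsic transfer is now a
tree theorem for the good-ordinary member of a route-G pair at an odd prime (see
`GreenbergVatsalTransferCurve` for the assembled statement).

References: Greenberg–Vatsal 2000, §2 p. 26; Silverman, *AEC* 2nd ed., III.8.1, VII.2.1; Serre,
*Local Fields*, IV §4 Prop. 17; Greenberg, LNM 1716, §1 p. 62.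
-/

section Part3

open scoped _root_.Classical AddSubgroup _root_.NNReal

open _root_.NumberField _root_.IsDedekindDomain _root_.Field
open Literature.NumberTheory.EllipticCurves Literature.NumberTheory.EllipticCurves.GreenbergSelmer
  Literature.NumberTheory.GaloisRepresentations _root_.IsDedekindDomain.HeightOneSpectrum
  Literature.NumberTheory.EllipticCurves.RibetGoodLattice.GreenbergVatsalTorsion
  Literature.NumberTheory.EllipticCurves.RibetGoodLattice.GreenbergVatsalReductionDatum
open _root_.WeierstrassCurve (minimalDiscriminantInt integralModelInt)

universe u

namespace Literature.NumberTheory.EllipticCurves.RibetGoodLattice.GreenbergVatsalReductionDatumLine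

variable (W : WeierstrassCurve ℚ) [W.IsGloballyMinimal] [W.IsElliptic] (p : ℕ) [hp : Fact p.Prime]
  {v : HeightOneSpectrum (𝓞 ℚ)}

/-- **The ordinary line `C[p] = ker(E[p] → Ẽ)` of `E(K̄_v)` and the scalar `2` on it.** For a
globally minimal `E/ℚ`, an ODD prime `p ∤ Δ_E` with `p ∤ a_p` (good ordinary) and the place `v ∋ p`:
there are a point `P₁ ∈ E(K̄_v)` of order `p` with `red_v P₁ = 0` generating
`ker red_v ∩ E(K̄_v)[p]`, and an element `σ₀` of the local INERTIA group with `σ₀ P₁ = 2 P₁`.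
Proof: the ordinary filtration (`localRed_ordinary_filtration`: `ker red_v ∩ E[p]` is cyclic of
order `p`), inertia acts on it by scalars `c(σ)` and trivially on `E(K̄_v)[p]/ℤP₁`
(`localRed_smul_of_mem_absInertia`), so by the WEIL PAIRING (`localPoints_exists_isPrimitiveRoot_smul_eq_pow`,
Silverman III.8.1: `det ρ̄ = χ̄`) there is a primitive `p`-th root of unity `ζ` with `σζ = ζ^{c(σ)}`
on inertia — i.e. `C[p] ≅ μ_p` as an `I_p`-module (GV p. 26: "By the Weil pairing, one sees that the
inertia group `I_p` acts on `C` by the `p`-cyclotomic character … `C[p] = μ_p`"); and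
`χ_p(I_{ℚ_v}) = ℤ_p^×` (`adicCompletion_rat_exists_mem_absInertia_cyclotomicCharacter_eq`, local
Kronecker–Weber) provides `σ₀ ∈ I_{ℚ_v}` with `χ_p(σ₀) = 2`.
[cite: GreenbergVatsal2000, §2 p. 26] [cite: SilvermanAEC2009, Prop. III.8.1] -/
theorem exists_generator_and_inertia_smul_eq_two (hp2 : p ≠ 2) (hpv : ((p : ℕ) : 𝓞 ℚ) ∈ v.asIdeal)
    (hΔ : ¬ (p : ℤ) ∣ minimalDiscriminantInt W) (hord : ¬ (p : ℤ) ∣ W.frobeniusTrace p) :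
    ∃ (P₁ : localPoints W (v.adicCompletion ℚ)) (σ₀ : absoluteGaloisGroup (v.adicCompletion ℚ)),
      localRed W p hpv hΔ P₁ = 0 ∧ addOrderOf P₁ = p ∧
      (∀ P : localPoints W (v.adicCompletion ℚ), localRed W p hpv hΔ P = 0 → (p : ℤ) • P = 0 →
        ∃ j : ℕ, P = j • P₁) ∧
      σ₀ ∈ absInertia (v.adicCompletion ℚ) ∧ σ₀ • P₁ = (2 : ℕ) • P₁ := by
  -- NB: no `CharZero (ℚ_v)` instance is put in scope (it would switch the `ℚ`-algebra structure of
  -- `ℚ_v` to `DivisionRing.toRatAlgebra` and break the identification of `localPoints`).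
  haveI : NeZero ((p : ℕ) : v.adicCompletion ℚ) := ⟨by
    rw [← map_natCast (algebraMap ℚ (v.adicCompletion ℚ))]
    exact (map_ne_zero_iff _ (algebraMap ℚ (v.adicCompletion ℚ)).injective).mpr
      (Nat.cast_ne_zero.mpr hp.out.ne_zero)⟩
  have hpp : 2 < p := lt_of_le_of_ne hp.out.two_le (Ne.symm hp2)
  set red := localRed W p hpv hΔ with hred
  have hΔu := W.isUnit_Δ_localIntModel hpv (specVal_spec v) hΔ
  have hvO : (specVal v).Integers (specVal v).valuationSubring :=
    Valuation.valuationSubring.integers (specVal v)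
  -- residue characteristic `p`
  have hpO : specVal v ((p : ℕ) : AlgebraicClosure (v.adicCompletion ℚ)) < 1 := by
    have h := spectralValuation_algebraMap_ringOfIntegers_lt_one (v := v) (specVal_spec v) hpv
    rwa [map_natCast] at h
  haveI hchar : CharP (IsLocalRing.ResidueField ↥(specVal v).valuationSubring) p := by
    refine (CharP.charP_iff_prime_eq_zero hp.out).mpr ?_
    rw [← map_natCast (IsLocalRing.residue ↥(specVal v).valuationSubring),
      IsLocalRing.residue_eq_zero_iff, IsLocalRing.mem_maximalIdeal, mem_nonunits_iff,
      hvO.isUnit_iff_valuation_eq_one]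
    exact fun h ↦ absurd h (ne_of_lt (by simpa using hpO))
  -- the ordinary filtration at level `p`
  have hordA := W.exists_zsmul_eq_zero_localRed_ne_zero (specVal_spec v) hΔu red (fun _ ↦ rfl)
    hpv hΔ hord
  obtain ⟨hgenr, -, -⟩ := W.localRed_ordinary_filtration hΔu red (fun _ ↦ rfl) hordA
  obtain ⟨P₁, hP₁red, hP₁ord, hP₁gen⟩ := hgenr 1
  rw [pow_one] at hP₁ord
  have hP₁gen' : ∀ P : localPoints W (v.adicCompletion ℚ), red P = 0 → (p : ℤ) • P = 0 →
      ∃ j : ℕ, P = j • P₁ := fun P hP hpP ↦ hP₁gen P hP (by rw [pow_one]; exact hpP)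
  -- inertia acts by scalars on `P₁` and trivially on `E(K̄_v)[p] / ℤ P₁`
  have hsc : ∀ σ : absoluteGaloisGroup (v.adicCompletion ℚ), ∃ cσ : ℕ,
      σ ∈ absInertia (v.adicCompletion ℚ) → σ • P₁ = cσ • P₁ := by
    intro σ
    by_cases hσ : σ ∈ absInertia (v.adicCompletion ℚ)
    · have hσp : (p : ℤ) • (σ • P₁) = σ • ((p : ℤ) • P₁) :=
        (map_zsmul (DistribSMul.toAddMonoidHom (localPoints W (v.adicCompletion ℚ)) σ)
          (p : ℤ) P₁).symm
      obtain ⟨cσ, h⟩ := hP₁gen' (σ • P₁)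
        (by rw [hred, localRed_smul_of_mem_absInertia W p hpv hΔ hσ, ← hred, hP₁red])
        (by rw [hσp, ← hP₁ord, natCast_zsmul, addOrderOf_nsmul_eq_zero, smul_zero])
      exact ⟨cσ, fun _ ↦ h⟩
    · exact ⟨0, fun h ↦ absurd h hσ⟩
  choose c hc using hsc
  have h2 : ∀ σ ∈ (absInertia (v.adicCompletion ℚ) : Set (absoluteGaloisGroup (v.adicCompletion ℚ))),
      ∀ Q : localPoints W (v.adicCompletion ℚ), ((p ^ 1 : ℕ) : ℤ) • Q = 0 →
        ∃ d : ℕ, σ • Q - (fun _ ↦ (1 : ℕ)) σ • Q = d • P₁ := by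
    intro σ hσ Q hQ
    rw [pow_one] at hQ
    have hσQ : (p : ℤ) • (σ • Q) = σ • ((p : ℤ) • Q) :=
      (map_zsmul (DistribSMul.toAddMonoidHom (localPoints W (v.adicCompletion ℚ)) σ)
        (p : ℤ) Q).symm
    obtain ⟨d, hd⟩ := hP₁gen' (σ • Q - Q)
      (by rw [map_sub, hred, localRed_smul_of_mem_absInertia W p hpv hΔ hσ, sub_self])
      (by rw [smul_sub, hσQ, hQ, smul_zero, sub_zero])
    exact ⟨d, by rw [one_smul]; exact hd⟩
  -- the Weil pairing: a primitive `p`-th root of unity on which inertia acts by the same scalars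
  obtain ⟨ζ, hζ, hζσ⟩ := @WeierstrassCurve.localPoints_exists_isPrimitiveRoot_smul_eq_pow ℚ _ W _
    (v.adicCompletion ℚ) _ _
    (charZero_of_injective_algebraMap (algebraMap ℚ (v.adicCompletion ℚ)).injective) p _ 1 P₁
    (by rw [pow_one]; exact hP₁ord)
    (absInertia (v.adicCompletion ℚ) : Set (absoluteGaloisGroup (v.adicCompletion ℚ)))
    c (fun _ ↦ 1) (fun σ hσ ↦ hc σ hσ) h2
  rw [pow_one] at hζ
  -- `χ_p(σ₀) = 2` for some `σ₀` in the local inertia group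
  have h2unit : IsUnit ((2 : ℕ) : ℤ_[p]) := by
    rw [PadicInt.isUnit_iff]
    refine le_antisymm (PadicInt.norm_le_one _) (not_lt.mp fun hlt ↦ ?_)
    have hlt' : ‖(((2 : ℕ) : ℤ) : ℤ_[p])‖ < 1 := by exact_mod_cast hlt
    have hdvd : (p : ℤ) ∣ ((2 : ℕ) : ℤ) := (PadicInt.norm_int_lt_one_iff_dvd _).mp hlt'
    have hdvd' : p ∣ 2 := by exact_mod_cast hdvd
    exact hp2 ((Nat.prime_dvd_prime_iff_eq hp.out Nat.prime_two).mp hdvd')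
  have hvp : (Rat.HeightOneSpectrum.primesEquiv v : ℕ) = p :=
    Rat.HeightOneSpectrum.primesEquiv_eq_of_natCast_mem v hp.out hpv
  obtain ⟨σ₀, hσ₀I, hχ⟩ :=
    adicCompletion_rat_exists_mem_absInertia_cyclotomicCharacter_eq p v hvp h2unit.unit
  have hζp : ζ ^ p ^ 1 = 1 := by rw [pow_one]; exact hζ.pow_eq_one
  have hσ₀ζ : σ₀ • ζ = ζ ^ 2 := by
    rw [GaloisRep.cyclotomicCharacter_spec (v.adicCompletion ℚ) p σ₀ ζ hζp, hχ, IsUnit.unit_spec,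
      map_natCast, ZMod.val_natCast, pow_one, Nat.mod_eq_of_lt hpp]
  -- compare exponents: `c σ₀ ≡ 2 (mod p)`
  have hcmp : ζ ^ (c σ₀ % p) = ζ ^ 2 := by
    rw [← hσ₀ζ, hζσ σ₀ hσ₀I, one_mul, hζ.eq_orderOf, pow_mod_orderOf]
  have hmod : c σ₀ % p = 2 :=
    hζ.pow_inj (Nat.mod_lt _ hp.out.pos) hpp hcmp
  refine ⟨P₁, σ₀, hP₁red, hP₁ord, hP₁gen', hσ₀I, ?_⟩
  rw [hc σ₀ hσ₀I, ← hmod, ← hP₁ord, mod_addOrderOf_nsmul]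

/-- **`hgen` for Greenberg's datum: the inertia group MOVES every point of `C[p]`** — for every
`c ∈ C_v ∩ E[p^∞][p]` there are `τ ∈ I_v` and `c' ∈ C_v ∩ E[p^∞][p]` with `τ•c' − c' = c` (take
`τ = res σ₀` with `χ_p(σ₀) = 2` and `c' = c`: `σ₀` acts on the line `C[p] ≅ μ_p` as `2`). This is
the hypothesis `hgen` of `GreenbergVatsalTorsionLine.natCard_gvSelmer_inf_torsion_mul_eq_of_inertia`
/ `GreenbergVatsalTorsionInvariants.natCard_gvSelmer_inf_torsion_eq_of_inertia`, DISCHARGED for the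
good-ordinary member of a route-G pair at an odd prime (GV p. 26: "since we are assuming that `p` is
odd, the subgroup `C[p]` of `A[p]` is determined by the action of `I_p`: `C[p] = μ_p`").
[cite: GreenbergVatsal2000, §2 p. 26] [cite: SilvermanAEC2009, Prop. III.8.1] -/
theorem reductionData_hgen (hp2 : p ≠ 2) (hΔ : ¬ (p : ℤ) ∣ minimalDiscriminantInt W)
    (hord : ¬ (p : ℤ) ∣ W.frobeniusTrace p) :
    ∀ (v : HeightOneSpectrum (𝓞 ℚ)) (hv : ((p : ℕ) : 𝓞 ℚ) ∈ v.asIdeal),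
      ∀ c ∈ (torsionData (reductionData W p hΔ) p v hv).plus, ∃ τ ∈ inertia v,
        ∃ c' ∈ (torsionData (reductionData W p hΔ) p v hv).plus, τ • c' - c' = c := by
  intro v hv c hc
  obtain ⟨P₁, σ₀, -, -, hP₁gen, hσ₀I, hσ₀P₁⟩ :=
    exists_generator_and_inertia_smul_eq_two W p hp2 hv hΔ hord
  refine ⟨absGaloisRestrict ℚ (v.adicCompletion ℚ) σ₀, Subgroup.mem_map_of_mem _ hσ₀I, c, hc, ?_⟩
  -- `ι c = j • P₁`
  have hcC : localRed W p hv hΔ (pointsMap W (v.adicCompletion ℚ)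
      (((c : (W.geomPrimaryTorsion p)) : W.geomPoints))) = 0 := hc
  have hcp : (p : ℤ) • pointsMap W (v.adicCompletion ℚ) ((c : W.geomPrimaryTorsion p) : W.geomPoints)
      = 0 := by
    have h : p • (c : (W.geomPrimaryTorsion p)[(p : ℤ)]) = 0 := AddSubgroup.torsionBy.nsmul c
    have h' := congrArg (fun z : (W.geomPrimaryTorsion p)[(p : ℤ)] ↦
      pointsMap W (v.adicCompletion ℚ) ((z : W.geomPrimaryTorsion p) : W.geomPoints)) h
    simp only [AddSubgroupClass.coe_nsmul, map_nsmul, ZeroMemClass.coe_zero, map_zero] at h'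
    rw [natCast_zsmul]; exact h'
  obtain ⟨j, hj⟩ := hP₁gen _ hcC hcp
  -- compare in `E(K̄_v)` via the injection `ι`
  apply Subtype.ext
  apply Subtype.ext
  apply pointsMapOfEmb_injective W (closureEmb (K := ℚ) (v.adicCompletion ℚ))
  change pointsMap W (v.adicCompletion ℚ)
      (((absGaloisRestrict ℚ (v.adicCompletion ℚ) σ₀ • c - c : (W.geomPrimaryTorsion p)[(p : ℤ)]) :
        W.geomPrimaryTorsion p) : W.geomPoints) =
    pointsMap W (v.adicCompletion ℚ) ((c : W.geomPrimaryTorsion p) : W.geomPoints)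
  rw [AddSubgroupClass.coe_sub, AddSubgroupClass.coe_sub, map_sub]
  change pointsMap W (v.adicCompletion ℚ)
      (absGaloisRestrict ℚ (v.adicCompletion ℚ) σ₀ • ((c : W.geomPrimaryTorsion p) : W.geomPoints)) -
    pointsMap W (v.adicCompletion ℚ) ((c : W.geomPrimaryTorsion p) : W.geomPoints) = _
  rw [pointsMap_absGaloisRestrict_smul, hj]
  have hσj : σ₀ • (j • P₁) = j • (σ₀ • P₁) :=
    map_nsmul (DistribSMul.toAddMonoidHom (localPoints W (v.adicCompletion ℚ)) σ₀) j P₁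
  rw [hσj, hσ₀P₁, two_nsmul, nsmul_add, add_sub_cancel_right]

end Literature.NumberTheory.EllipticCurves.RibetGoodLattice.GreenbergVatsalReductionDatumLine

end Part3

/-!
## Part 4 — port of `Summits/BirchSwinnertonDyer/Rank1Residual/X1/TamagawaSqueeze.lean` (2 declarations kept)

# Route T — the squeeze with an ALGEBRAIC λ LOWER BOUND on the leaf X1 ∩ {r = 0}:
# `μ-part ∧ λ_an = n ∧ λ_alg ≥ n − 1` ⇒ Mazur's main conjecture ⇒ `BSD(E,p)`

WHY THIS FILE. Route P (`X1/ParitySqueeze.lean`, gen 5) closes Mazur's main conjecture at a leaf pair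
with `λ_an = 2`: Kato–Wuthrich give `ϖ·L_p = ι(f_E·h)`, the μ-part gives `μ(h) = 0`, parity
(Greenberg Prop. 3.10 + the MTT functional equation) gives `λ(f_E)` and `λ_an` even, and Greenberg's
Thm. 4.1 excludes `λ(f_E) = 0`; so `λ(h) = 0` and `h ∈ Λˣ`. The ONLY place where "`2`" enters is the
last step: a LOWER BOUND `λ(f_E) ≥ 1`. This file isolates that step: **any lower bound
`λ_alg(E,p) = λ(X(E/ℚ_∞)) ≥ k` with `λ_an ≤ k + 1` closes the main conjecture** (with parity; with
`λ_an ≤ k` even without it) — route T. The lower bound is a TYPED INPUT here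
(`AlgebraicLambdaGE W p k`); its source IN PRINT is Greenberg's proof of LNM 1716 Cor. 5.6 (p. 136:
"We will show that `λ_E ≥ |L|`": each bad prime `ℓ` with `p ∣ c_ℓ` puts a `ℤ/p` into
`ker(𝒫_E(ℚ) → 𝒫_E(ℚ_∞))` (Lemma 3.3 and the remark after it: `|ker r_v| = c_v^{(p)}`), hence — through
the snake lemma of the control diagram (Lemma 3.2: `coker h = 0`; Cassels' theorem Prop. 4.13 for the
index `[𝒫 : 𝒢] = #E(ℚ)_p`) — into `coker(Sel_E(ℚ)_p → Sel_E(ℚ_∞)_p^Γ)`, and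
`Sel_E(ℚ_∞)_p ≅ (ℚ_p/ℤ_p)^λ` when `μ_E = 0` (no proper finite-index `Λ`-submodules for `F = ℚ`,
`p` odd, good ordinary or multiplicative reduction: LNM 1716 p. 161 / Prop. 4.15)), run over the
LAYERS `ℚ_m` of the cyclotomic tower (a prime `ℓ ≠ p` has `min(s_ℓ, p^m)` primes above it in `ℚ_m`,
`s_ℓ = p^{ord_p(ℓ^{p−1} − 1) − 1}`, each contributing): at a member `E` with `μ_an(E) = 0`,
`λ_alg ≥ Σ_{ℓ bad, p ∣ c_ℓ(E)} s_ℓ + a − 2·[p ∣ #E(ℚ)_tors]`, where `a ∈ {1, 2}` is the `p`-rank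
of the anomalous local kernel `ker r_𝔭` (`|ker r_𝔭| = #Ẽ(𝔽_p)(p)² = p²`, Lemma 3.4; `a = 2` on the
leaf because `E(ℚ_p)` has a point of order `p` — the type-A kernel `Φ` is `G_{ℚ_p}`-trivial — so
`E(ℚ_p)^∧/(universal norms) = (Ê ⊕ ⟨P⟩)/pÊ ≅ (ℤ/p)²`; HOME/b2b-bsdres-eisenstein-p1/X1R0-GAPMAP.md
§14.2). That composition lives OUTSIDE the kernel (the tree has no local kernels `ker r_v` over the
layers `ℚ_m`); it is a per-pair CERTIFICATE recipe with integer data (Tamagawa numbers, `s_ℓ`,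
torsion), checked by `HOME/b2b-bsdres-eisenstein-p1/routeT/routeT_census.py` against iw-2's two-engine
`λ_an` on all 826 `μ = 0` members of the 770 leaf classes with `N < 2·10⁴` (0 violations of
`bound ≤ λ_an`, equality on 350) and closing **141 of the 315 leaf classes with `λ_an ≥ 4`** (and
432/433 of the `λ_an = 2` classes independently of route P). K. Matsuno, Manuscripta Math. 122 (2007)
289–304 (acq-07131, not yet held) is the expected printed form of the tower bound for curves with a
rational `p`-isogeny; until it is read, `AlgebraicLambdaGE` stays a TYPED input and nothing is booked.

* `AlgebraicLambdaGE W p n` (TYPED): "`λ(X(E/ℚ_∞)) ≥ n`" for the cyclotomic dual datum — nothing asserted.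
* the squeeze in `Λ` is `λ(f_E·h) = λ(f_E) + λ(h)` (`MuLambda.lam_mul`; cf. x1b's
  `RankOneParitySqueeze.isUnit_of_mu_le_of_lam_le`), inlined below.
* `lambdaPartAt_of_algebraicLambdaGE` (`λ_an ≤ k`), `lambdaPartAt_of_algebraicLambdaGE_of_even`
  (`λ_an ≤ k + 1`, `λ_an` even, `Sel_{p^∞}(E/ℚ)` finite, Prop. 3.10) — the λ-PART of `X1/MuLambda.lean`.
* `mazurMainConjecture_of_algebraicLambdaGE(_of_even)` — with `MuPartAt`, Mazur's main conjecture.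
* `Leaf.…` — on the leaf: `BSD(E,p)`; headline **`μ_an = 0 ∧ λ_an = n ∧ λ_alg ≥ n − 1 ⇒ BSD(E,p)`**.
* `Leaf.le_of_algebraicLambdaGE_of_analyticLambdaEq` — consistency (Kato–Wuthrich): a certified
  lower bound never exceeds `λ_an` (the census's falsification test, in the kernel).

References: [GreenbergLNM1716] Lemma 3.2–3.4 and remark (pp. 86–89 of the volume), Prop. 3.10,
Thm. 4.1, Prop. 4.13, Prop. 4.15 and p. 161, Cor. 5.6 (p. 136); [Wuthrich2014] Thm. 16;
[GreenbergVatsal2000] (1)–(2); HOME/b2b-bsdres-eisenstein-p1/X1R0-GAPMAP.md §13–§14.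
-/

section Part4

open scoped _root_.Classical _root_.MatrixGroups _root_.ModularForm

open _root_.PowerSeries _root_.CongruenceSubgroup _root_.WeierstrassCurve Literature.NumberTheory.EllipticCurves
  Literature.NumberTheory.EllipticCurves.ModularForms Literature.NumberTheory.EllipticCurves.Rank1Residual

set_option autoImplicit false

namespace Literature.NumberTheory.EllipticCurves.RibetGoodLattice.TamagawaSqueeze

/-! ## §1. "`λ_alg(E,p) ≥ n`", TYPED (nothing asserted) -/

/-- **"`λ_alg(E,p) ≥ n`" (TYPED; nothing asserted).** For the cyclotomic `ℤ_p`-extension `κ`, a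
topological generator `γ`, and every Pontryagin-dual datum `D` (`D.X = X(E/ℚ_∞) = Sel_{p^∞}(E/ℚ_∞)^∧`,
finitely generated and `Λ`-torsion): `n ≤ λ(D.X)`, `λ = dim_{ℚ_p}(X ⊗ ℚ_p)` the tree's
`lambdaInvariant` (= `corank_{ℤ_p} Sel_E(ℚ_∞)_p`, Greenberg's `λ_E`). An INPUT of route T, supplied per
pair OUTSIDE the kernel by Greenberg's Cor. 5.6 mechanism over the layers `ℚ_m` (module docstring):
at a member with `μ_an = 0`, `n = Σ_{ℓ bad, p ∣ c_ℓ} s_ℓ + a − 2·[p ∣ #E(ℚ)_tors]`.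
[cite: GreenbergLNM1716, Cor. 5.6 (proof, p. 136: "We will show that λ_E ≥ |L|") (shape only; nothing asserted)] -/
def AlgebraicLambdaGE (W : WeierstrassCurve ℚ) [W.IsElliptic] [W.IsGloballyMinimal] (p : ℕ)
    [Fact p.Prime] (n : ℕ) : Prop :=
  ∀ (κ : ZpExtension ℚ p) (γ : Field.absoluteGaloisGroup ℚ),
      κ.IsCyclotomic → κ.IsTopGenerator γ →
    ∀ (D : W.SelmerDualData κ γ) [Module.Finite (IwasawaAlgebra p) D.X], D.IsTorsion →
      n ≤ lambdaInvariant p D.X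

/-- `AlgebraicLambdaGE` is monotone: a bound `n` gives every bound `m ≤ n`. [cite: GreenbergLNM1716, Prop. 3.10 and Cor. 5.6 (proof, p. 136) (the algebraic λ-invariant lower bound; definition only)] -/
theorem AlgebraicLambdaGE.mono {W : WeierstrassCurve ℚ} [W.IsElliptic] [W.IsGloballyMinimal] {p : ℕ}
    [Fact p.Prime] {m n : ℕ} (hmn : m ≤ n) (h : AlgebraicLambdaGE W p n) :
    AlgebraicLambdaGE W p m :=
  fun κ γ hκ hγ D _ hX ↦ hmn.trans (h κ γ hκ hγ D hX)

section Squeeze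

variable {W : WeierstrassCurve ℚ} [W.IsElliptic] [W.IsGloballyMinimal] {p : ℕ} [Fact p.Prime]

end Squeeze

/-! ## §3. On the leaf X1 ∩ {r = 0}: route T closes `BSD(E,p)` -/

section Leaf

variable {W : WeierstrassCurve ℚ} [W.IsElliptic] [W.IsGloballyMinimal] {p : ℕ} [Fact p.Prime]

end Leaf

end Literature.NumberTheory.EllipticCurves.RibetGoodLattice.TamagawaSqueeze

end Part4

/-!
## Part 5 — port of `Summits/BirchSwinnertonDyer/Rank1Residual/X1/CongruenceTransfer.lean` (2 declarations kept)

# Route G — the GREENBERG–VATSAL CONGRUENCE TRANSFER of `λ` on the leaf X1 ∩ {r = 0}: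
# `E₀[p] ≅ E₀'[p]`, both `μ = 0`, Mazur's main conjecture at `E₀'` ⇒ `λ_alg(E₀)` is determined ⇒
# (squeeze of route T) Mazur's main conjecture and `BSD(E,p)` at `E₀`

WHY THIS FILE. Routes P/T/C (gens 5–6) bound `λ_alg(E,p) = λ(X(E/ℚ_∞))` from below by invariants of
`E` itself (parity, Tamagawa kernels over the tower, points over `ℚ_1`). Greenberg–Vatsal, Invent.
Math. 142 (2000), §2, show that `λ` is — up to EXPLICIT local terms — an invariant of the residual
representation: (p. 26, last paragraph – p. 27) "by proposition (2.8), we have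
`Sel^{Σ₀}_{E_i}(ℚ_∞)[p] = S^{Σ₀}_{A_i}(ℚ_∞)[p] ≅ S^{Σ₀}_{A_i[p]}(ℚ_∞)`. Furthermore, the order of
this group is independent of `i` since `A₁[p] ≅ A₂[p]` as `G_ℚ`-modules. As a consequence, we see
that if `μ_{E₁} = 0`, then `μ_{E₂} = 0` and `λ^{Σ₀}_{E₂} = λ^{Σ₀}_{E₁}`. … The above discussion shows
that if `p` is an odd prime, `E₁[p] ≅ E₂[p]` as `G_ℚ`-modules, and `μ^{alg}_{E₁} = 0`, then one can
compute `λ^{alg}_{E₂}` if one knows `λ^{alg}_{E₁}`", with `λ^{Σ₀}_E = λ_E + Σ_{ℓ ∈ Σ₀} δ_E(ℓ)`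
((6)–(9): Cor. 2.3, Prop. 2.4), `δ_E(ℓ) = s_ℓ · d_ℓ`, `s_ℓ = p^{ord_p(ℓ^{p−1}−1)−1}` the number of
primes of `ℚ_∞` above `ℓ` and `d_ℓ` the multiplicity of `ℓ^{-1}` as a root of the Euler factor
`P_ℓ(X) mod p` (p. 27, the example `52a/364a @ 5`: "`1 + 2X + 7X² ≡ (1 − X)(1 − 2X) (mod 5)` and
`X = 7̃^{-1}` has multiplicity 1 as a root. Also `5² ∥ 7⁴ − 1` and so `s₇ = 5` … `δ^{(7)}_{E₁} = 5`").
The hypothesis printed in Prop. (2.8) is `H⁰(ℚ, E[p]) = 0`, NOT irreducibility (Thm. (1.4) assumes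
irreducible `E[p]` for its ANALYTIC half, §3); when `E(ℚ)[p] ≠ 0` one adds the remark
`dim_{𝔽_p} S^{Σ₀}_{A[p]}(ℚ_∞) = λ^{Σ₀} + dim_{𝔽_p} E(ℚ_∞)[p]` (HOME/b2b-bsdres-eisenstein-p1/
X1R0-GAPMAP.md §16.0; the correction depends on `A[p]` only, so `λ^{Σ₀}` is an invariant of
(`E[p]`, `μ = 0`) for every `E/ℚ` good ordinary at odd `p`). So for two leaf classes whose `μ = 0`
members have ISOMORPHIC `E₀[p]`, **`λ_alg(E₀) = λ_alg(E₀') + e`** with the integer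
`e = Σ_{ℓ ∣ NN', ℓ ≠ p} s_ℓ (d_ℓ(E₀') − d_ℓ(E₀))` read off the reduction types — and if Mazur's main
conjecture is known at `E₀'` (routes S/P/T/C at `r = 0`, x1b's P1/P3 at `r = 1`) then
`λ_alg(E₀) = λ_an(E₀') + e` is KNOWN, and route T's squeeze closes `E₀` as soon as this integer is
`≥ λ_an(E₀) − 1`. That composition lives OUTSIDE the kernel (the tree has no non-primitive Selmer
groups of `E[p]` over `ℚ_∞`); it is a per-pair CERTIFICATE whose finite data are: the isomorphism
class of `E₀[3]` — at `p = 3`, EXACTLY, as (the even character `φ = χ_d`, the Kummer line in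
`ℚ^×/ℚ^{×3}` of the extension class, read off the `3`-division polynomial), two certified `λ_an`, two
certified `μ_an = 0`, reduction types and `s_ℓ` (`HOME/b2b-bsdres-eisenstein-p1/routeG/`: on the 1 389
X1 classes at `p = 3`, `N < 2·10⁴`, EVERY one of the 794 closed–closed predictions is exact, 14 open
`r = 0` classes close (census reach 643/770), 69 `r = 1` classes get the λ-part).

* `TorsionIso`, `CongruentLambdaShift` (TYPED) — §1; `isTorsion_and_lambdaInvariant_eq_of_mazurMainConjecture`
  (at the partner `λ(X') = n'`) — §2; `lambdaInvariant_eq_of_congruentLambdaShift` (`λ(X) = n' + e`),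
  `lambdaPartAt_of_congruentLambdaShift(_of_even)`, `mazurMainConjecture_of_congruentLambdaShift_of_even`
  — §3; `Leaf.mazurMainConjecture_of_congruent`, **`Leaf.bsdp_of_muZero_of_congruent(_leaf)`**,
  `Leaf.le_of_congruentLambdaShift` (consistency, Kato's direction) — §4.

References: [GreenbergVatsal2000] §2: Props. (2.1), (2.4), (2.5), (2.8), Cor. (2.3), pp. 24–27 of
arXiv:math/9906215; [GreenbergLNM1716] Prop. 3.10, p. 161; [Wuthrich2014] Thm. 16;
HOME/b2b-bsdres-eisenstein-p1/X1R0-GAPMAP.md §16.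
-/

section Part5

open scoped _root_.Classical _root_.MatrixGroups _root_.ModularForm

open _root_.PowerSeries _root_.CongruenceSubgroup _root_.WeierstrassCurve Literature.NumberTheory.EllipticCurves
  Literature.NumberTheory.EllipticCurves.ModularForms Literature.NumberTheory.EllipticCurves.Rank1Residual
  Literature.NumberTheory.EllipticCurves.RibetGoodLattice.TamagawaSqueeze

set_option autoImplicit false

namespace Literature.NumberTheory.EllipticCurves.RibetGoodLattice.CongruenceTransfer

/-! ## §1. "`E[p] ≅ E'[p]`" and the transfer statement, TYPED -/

/-- **"`E[p] ≅ E'[p]` as Galois modules"**: a `Γ_ℚ`-equivariant additive isomorphism between the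
geometric `p`-torsion subgroups — the hypothesis of Greenberg–Vatsal's Thm. (1.4), spelled as in the tree's
transfer theorem for Thm. (1.4) (`GreenbergVatsal2000`). A definition with a body (a `Prop` with binders), not a
named fact.
[cite: GreenbergVatsal2000, Thm. (1.4) (hypothesis "E₁[p] ≅ E₂[p] as Galois modules", arXiv p. 5)] -/
def TorsionIso (W W' : WeierstrassCurve ℚ) (p : ℕ) : Prop :=
  ∃ e : geomTorsion W (p : ℤ) ≃+ geomTorsion W' (p : ℤ),
    ∀ (σ : Field.absoluteGaloisGroup ℚ) (P : geomTorsion W (p : ℤ)), e (σ • P) = σ • e P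

/-- `TorsionIso` is symmetric. [cite: GreenbergVatsal2000, §2 p. 27 (Galois-equivariant isomorphism of p-torsions; definition and symmetry)] -/
theorem TorsionIso.symm {W W' : WeierstrassCurve ℚ} {p : ℕ} (h : TorsionIso W W' p) :
    TorsionIso W' W p := by
  obtain ⟨e, he⟩ := h
  refine ⟨e.symm, fun σ Q ↦ ?_⟩
  apply e.injective
  rw [e.apply_symm_apply, he, e.apply_symm_apply]

section Partner

variable {W' : WeierstrassCurve ℚ} [W'.IsElliptic] [W'.IsGloballyMinimal] {p : ℕ} [Fact p.Prime]

end Partner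

/-! ## §3. Route G: the transferred lower bound and the squeeze -/

section Transfer

variable {W W' : WeierstrassCurve ℚ} [W.IsElliptic] [W.IsGloballyMinimal]
  [W'.IsElliptic] [W'.IsGloballyMinimal] {p : ℕ} [Fact p.Prime]

end Transfer

/-! ## §4. On the leaf X1 ∩ {r = 0}: route G closes `BSD(E,p)` -/

section Leaf

variable {W W' : WeierstrassCurve ℚ} [W.IsElliptic] [W.IsGloballyMinimal]
  [W'.IsElliptic] [W'.IsGloballyMinimal] {p : ℕ} [Fact p.Prime]

end Leaf

end Literature.NumberTheory.EllipticCurves.RibetGoodLattice.CongruenceTransfer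

end Part5

/-!
## Part 6 — port of `Summits/BirchSwinnertonDyer/Rank1Residual/X2/GreenbergVatsalTateDatumCofree.lean` (2 declarations kept)

# The Tate datum `C ≅ μ_{p^∞}` is COFREE OF CORANK ONE (`C` divisible, `#C[p] = p`), and the full
# Tate data package at an odd `p ‖ N` (split / non-split) for GV's §2 statements

WHAT THIS FILE PROVES (step K-B1 of the `p ‖ N` Λ-bookkeeping for route G, X2-GAP §16.6/§17.4).
Greenberg–Vatsal's §2 statements (Prop. (2.5)/p. 25 — Literature fact
`datumSelmer_divisible_of_finite_torsionBy`; p. 15 — `datumStrictSelmer_lt_datumSelmer_of_split`)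
are typed for a Greenberg datum `C ⊂ A = E[p^∞]` of GV's shape "`C` = image of a
`G_{ℚ_p}`-invariant LINE" — `C` divisible with `#(C ∩ A[p]) = p` — with `D = A/C` unramified. Here:
* §0 the Literature objects `datumSelmer`/`datumStrictSelmer` (`GreenbergSelmerGroups`) ARE the
  cell's `gvSelmer` (gen 8) / `gvStrictSelmer` (gen 12): `rfl`;
* §1 `exists_primaryTorsion_pointsMap_eq`: a `p`-power torsion point of `E(K̄_v)` comes from
  `E[p^∞](K̄)` (torsion is algebraic, `torsionPointsEquiv`);
* §2 **`tateDatum_plus_divisible`**: the Tate datum `C = ι⁻¹Φ(μ)` is `p`-DIVISIBLE (`p`-th roots of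
  roots of unity exist in `K̄_v`); **`natCard_tateDatum_plus_inf_torsionBy`**: `#(C ∩ E[p^∞][p]) = p`
  (`C[p] = ι⁻¹Φ(μ_p) ≅ μ_p(K̄_v)`, `Φ` injective on roots of unity, `#μ_p = p`) — GV p. 14
  "`C ≅ μ_{p^∞}`", i.e. `W_p` is a LINE;
* §3 **`exists_data_of_not_split` / `exists_data_of_split`**: at an odd non-split / split `p ‖ N`
  of `E/ℚ`, ONE Tate data `L` above `p` carrying ALL the properties the gen-13 count needs — GV's
  `htriv`, `hgen` (`I_p` moves every point of `C[p]`), the corank-one shape, the two Kummer/strict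
  inclusions `localKerOver ≤ strictKer ≤ localKerOver`, and `greenbergKer = strictKer` (non-split)
  resp. `D_v` trivial on `D` (split) — granted only the Tate uniformisation facts A41 / A40.

References: Greenberg–Vatsal 2000 §2 pp. 14–16, 23–26; Silverman *ATAEC* V.3.1, V.5.3; *AEC* III.6.4.
-/

section Part6

open scoped _root_.Classical AddSubgroup

universe u

namespace Literature.NumberTheory.EllipticCurves.RibetGoodLattice.GreenbergVatsalTateDatumCofree

open _root_.NumberField _root_.IsDedekindDomain _root_.Field Literature.NumberTheory.GaloisRepresentations
  Literature.NumberTheory.EllipticCurves Literature.NumberTheory.EllipticCurves.GreenbergSelmer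
  Literature.NumberTheory.EllipticCurves.GreenbergVatsal2000 _root_.IsDedekindDomain.HeightOneSpectrum
  Literature.NumberTheory.EllipticCurves.RibetGoodLattice.GreenbergVatsalTorsion

/-! ## §0. The Literature objects are the cell's objects (definitional) -/

section Bridge

variable {K : Type u} [Field K] [NumberField K] (H : Subgroup (absoluteGaloisGroup K)) [H.Normal]
  (M : Type u) [AddCommGroup M] [DistribMulAction (absoluteGaloisGroup K) M] [TopologicalSpace M]
  [DiscreteTopology M] (p : ℕ) (L : Data K M p) (S₀ : Set (HeightOneSpectrum (𝓞 K)))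

end Bridge

/-! ## §1. `p`-power torsion of `E(K̄_v)` comes from `E[p^∞](K̄)` -/

section Lift

variable {K : Type u} [Field K] [NumberField K] (W : WeierstrassCurve K) [W.IsElliptic] (p : ℕ)
  [hp : Fact p.Prime] {E : Type u} [Field E] [Algebra K E]

/-- **A `p^k`-torsion point of `E(K̄_E)` is `ι m` for some `m ∈ E[p^∞](K̄)`** (torsion points are
algebraic: the tree's `torsionPointsEquiv`, Silverman *AEC* III.6.4). [cite: SilvermanAEC2009, Cor. III.6.4(b)] -/
theorem exists_primaryTorsion_pointsMap_eq (T : localPoints W E) (k : ℕ) (hT : p ^ k • T = 0) :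
    ∃ m : W.geomPrimaryTorsion p, pointsMap W E (m : W.geomPoints) = T := by
  have hn : ((p ^ k : ℕ) : ℤ) ≠ 0 := by exact_mod_cast pow_ne_zero k hp.out.ne_zero
  have hT' : T ∈ AddSubgroup.torsionBy (localPoints W E) ((p ^ k : ℕ) : ℤ) := by
    rw [AddSubgroup.torsionBy, Submodule.mem_toAddSubgroup, Submodule.mem_torsionBy_iff]
    change ((p ^ k : ℕ) : ℤ) • T = 0
    rw [natCast_zsmul]; exact hT
  set P := (W.torsionPointsEquiv ((p ^ k : ℕ) : ℤ) (E := E) hn).symm ⟨T, hT'⟩ with hP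
  have hPmem : (P.1 : W.geomPoints) ∈ W.geomPrimaryTorsion p := by
    rw [WeierstrassCurve.geomPrimaryTorsion, AddCommGroup.mem_primaryComponent]
    refine ⟨k, ?_⟩
    have h := (W.mem_geomTorsion_iff ((p ^ k : ℕ) : ℤ) P.1).mp P.2
    rwa [natCast_zsmul] at h
  refine ⟨⟨P.1, hPmem⟩, ?_⟩
  change pointsMap W E P.1 = T
  have h := W.pointsMap_torsionPointsEquiv_symm ((p ^ k : ℕ) : ℤ) (E := E) hn ⟨T, hT'⟩
  rw [← hP] at h
  exact h

end Lift

/-! ## §2. The Tate datum is divisible with `#C[p] = p` -/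

section Cofree

variable {K : Type u} [Field K] [NumberField K] (W : WeierstrassCurve K) [W.IsElliptic] (p : ℕ)
  [hp : Fact p.Prime] {v : HeightOneSpectrum (𝓞 K)}
  (Φ : Additive (AlgebraicClosure (v.adicCompletion K))ˣ →+ localPoints W (v.adicCompletion K))
  (hΦ : ∀ (σ : absoluteGaloisGroup (v.adicCompletion K))
    (u : (AlgebraicClosure (v.adicCompletion K))ˣ),
    σ • Φ (Additive.ofMul u) = Φ (Additive.ofMul (Units.map
      (Field.absoluteGaloisGroup.toAlgEquiv (v.adicCompletion K) σ :
        AlgebraicClosure (v.adicCompletion K) →* AlgebraicClosure (v.adicCompletion K)) u)) ∨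
    σ • Φ (Additive.ofMul u) = -Φ (Additive.ofMul (Units.map
      (Field.absoluteGaloisGroup.toAlgEquiv (v.adicCompletion K) σ :
        AlgebraicClosure (v.adicCompletion K) →* AlgebraicClosure (v.adicCompletion K)) u)))
  {q : v.adicCompletion K} (hq0 : q ≠ 0) (hq1 : Valued.v q < 1)
  (hker : ∀ u : (AlgebraicClosure (v.adicCompletion K))ˣ, Φ (Additive.ofMul u) = 0 →
    ∃ a : ℤ, (u : AlgebraicClosure (v.adicCompletion K)) =
      algebraMap (v.adicCompletion K) (AlgebraicClosure (v.adicCompletion K)) q ^ a)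

omit [W.IsElliptic] hp in
/-- `ι = pointsMap ∘ subtype` is injective on `E[p^∞](K̄)`. [cite: GreenbergVatsal2000, §2 pp. 16–17, 20 (the p-primary torsion of E as points of the Tate-module datum)] -/
theorem pointsMap_coe_injective :
    Function.Injective fun m : W.geomPrimaryTorsion p ↦
      pointsMap W (v.adicCompletion K) (m : W.geomPoints) := by
  intro m m' h
  exact Subtype.ext (pointsMapOfEmb_injective W (closureEmb (K := K) (v.adicCompletion K)) h)

end Cofree

/-! ## §3. The full Tate data packages at an odd `p ‖ N` over `ℚ` -/

section Rat

variable (W : WeierstrassCurve ℚ) [W.IsGloballyMinimal] [W.IsElliptic] (p : ℕ) [hp : Fact p.Prime]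
  (κ : ZpExtension ℚ p)

end Rat

end Literature.NumberTheory.EllipticCurves.RibetGoodLattice.GreenbergVatsalTateDatumCofree

end Part6

/-!
## Part 7 — port of `Summits/BirchSwinnertonDyer/Rank1Residual/X2/TateLineDecomposition.lean` (5 declarations kept)

# Class X2 (odd multiplicative Eisenstein prime): the decomposition group at `p ‖ N` on `E[p]` —
# "`φ|_{G_p} ∉ {1, ω}`" at a NON-SPLIT prime, "`φ|_{G_p} ∈ {1, ω}`" at a SPLIT prime
# (cell `b2b-bsdres`, unit `b2b-bsdres-eisenstein-p2`, gen 15)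

## What this file proves

Let `E₀ = W/ℚ` be globally minimal, `p` an ODD prime of multiplicative reduction, `v ∋ p` the place
of `ℚ`, `D_v ≤ Γ_ℚ` the decomposition group of the tree's chosen prime above `v`
(`GreenbergSelmer.decomp v`, the image of `Γ_{ℚ_v}`), and `Φ ≤ E₀[p]` ANY `D_v`-stable subgroup of
order `p` (e.g. the kernel of a rational `p`-isogeny — an X2 pair is Eisenstein). Write
`X₀ = C ∩ E₀[p]` for the line cut out by the Tate datum `C = ι⁻¹Φ(μ)` of gens 9/12/13
(`GreenbergVatsalTateDatum.tateDatum`; `#X₀ = p`, `GreenbergVatsalTateDatumCofree`), granted the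
PUBLISHED Tate uniformisation (Silverman *ATAEC* V.5.3/V.5.4, tree facts A40/A41, hypotheses `hT`).

* `not_fix_and_not_quot_of_not_split` — **NON-SPLIT `p`: `D_v` neither fixes `Φ` pointwise nor acts
  trivially on `E₀[p]/Φ`** ("`φ|_{G_p} ≠ 1, ω`" for EVERY stable line: the Jordan–Hölder characters of
  `E₀[p]|_{G_p}` are `ωδ, δ` with `δ` the unramified quadratic character, `δ(Frob) = −1`). Inputs: an
  arithmetic Frobenius `τ ∈ Γ_{ℚ_v}` FLIPS `√γ` (gen 12 `frob_apply_sqrt_gamma_ne`), hence acts as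
  `−1` on `E₀[p^∞]/C` (gen 12 `smul_sub_sign_smul_mem`); the inertia group moves every point of
  `C[p]` (gen 9 `tateDatum_hgen`); `#C[p] = p` (gen 13).
* `fix_or_quot_of_split` — **SPLIT `p`: `D_v` fixes `Φ` pointwise or acts trivially on `E₀[p]/Φ`**
  (characters `ω, 1`): `D_v` acts trivially on `E₀[p^∞]/C` (gen 12 `smul_sub_mem_of_equivariant`).

Consumed by `X2/CongruentPartnerAnomalous.lean`: along a congruence `E₀[p] ≅ E₀'[p]` with a GOOD
partner `E₀'`, x1a's kernel dictionary (`Rank1Residual.anom_iff_decomposition_of_mem_primesAbove`,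
Serre 1972 §1.11) turns these into `a_p(E₀') ≢ 1 (mod p)` (non-split: the covered partner of gen 14 is
NON-ANOMALOUS, Castella–Grossi–Skinner 2025 Thm. A applies) resp. `a_p(E₀') ≡ 1 (mod p)` (split:
every good relative is ANOMALOUS — no published main conjecture on the congruence class).

References: [GreenbergVatsal2000] §2 pp. 14–15 (`C ≅ μ_{p^∞}(δ)`, `D = A/C ≅ ℚ_p/ℤ_p(δ)`);
[SilvermanATAEC1994] Ch. V Lemma 5.2 (c), Thm. 5.3, Cor. 5.4; [Serre1972] §1.12 Prop. 13 and Cor.;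
HOME/b2b-bsdres-eisenstein-p2/X2-GAP.md §20.
-/

section Part7

set_option autoImplicit false

open scoped _root_.Classical

open _root_.NumberField _root_.IsDedekindDomain _root_.Field _root_.WeierstrassCurve
  Literature.NumberTheory.EllipticCurves Literature.NumberTheory.GaloisRepresentations
  Literature.NumberTheory.EllipticCurves.GreenbergSelmer
  Literature.NumberTheory.EllipticCurves.RibetGoodLattice.GreenbergVatsalTateDatumCofree

namespace Literature.NumberTheory.EllipticCurves.RibetGoodLattice.TateLineDecomposition

variable (W : WeierstrassCurve ℚ) [W.IsElliptic] [W.IsGloballyMinimal] (p : ℕ) [hp : Fact p.Prime]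
  {v : HeightOneSpectrum (𝓞 ℚ)}

/-! ## §1. The line `X₀ = M⁺ ∩ E[p]` of a local datum on `E[p^∞]`, seen inside `E[p]` -/

section Line

variable (N : LocalDatum ℚ (W.geomPrimaryTorsion p) v)

omit [W.IsElliptic] [W.IsGloballyMinimal] hp in
/-- The inclusion `E[p] ↪ E[p^∞]` is `Γ_ℚ`-equivariant. [cite: GreenbergVatsal2000, §2 pp. 14–15 and p. 26 (lines of E[p] inside the p-primary torsion; inertia moves a non-kernel vector)] -/
theorem inclusion_smul (g : absoluteGaloisGroup ℚ) (P : geomTorsion W (p : ℤ)) :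
    AddSubgroup.inclusion (geomTorsion_le_geomPrimaryTorsion W p) (g • P) =
      g • AddSubgroup.inclusion (geomTorsion_le_geomPrimaryTorsion W p) P :=
  Subtype.ext rfl

omit [W.IsElliptic] [W.IsGloballyMinimal] hp in
/-- `m ∈ E[p^∞][p]` iff `p • m = 0` in `E(ℚ̄)`. [cite: GreenbergVatsal2000, §2 pp. 14–15 and p. 26 (lines of E[p] inside the p-primary torsion; inertia moves a non-kernel vector)] -/
theorem mem_torsionBy_primary_iff (m : W.geomPrimaryTorsion p) :
    m ∈ AddSubgroup.torsionBy (↥(W.geomPrimaryTorsion p)) (p : ℤ) ↔ p • (m : W.geomPoints) = 0 := by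
  rw [AddSubgroup.torsionBy.nsmul_iff, Subtype.ext_iff, AddSubmonoidClass.coe_nsmul,
    ZeroMemClass.coe_zero]

omit [W.IsElliptic] [W.IsGloballyMinimal] hp in
/-- Membership in `X₀ = M⁺ ∩ E[p]` (as a subgroup of `E[p]`: the preimage of `M⁺` under
`E[p] ↪ E[p^∞]`). [cite: GreenbergVatsal2000, §2 pp. 14–15 and p. 26 (lines of E[p] inside the p-primary torsion; inertia moves a non-kernel vector)] -/
theorem mem_comap_iff (P : geomTorsion W (p : ℤ)) :
    P ∈ N.plus.comap (AddSubgroup.inclusion (geomTorsion_le_geomPrimaryTorsion W p)) ↔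
      AddSubgroup.inclusion (geomTorsion_le_geomPrimaryTorsion W p) P ∈ N.plus :=
  Iff.rfl

omit [W.IsElliptic] [W.IsGloballyMinimal] hp in
/-- **`#X₀ = #(M⁺ ∩ E[p^∞][p])`**: `E[p] ↪ E[p^∞]` maps `X₀` bijectively onto `M⁺ ⊓ E[p^∞][p]`.
[cite: GreenbergVatsal2000, §2 pp. 14–15 and p. 26 (lines of E[p] inside the p-primary torsion; inertia moves a non-kernel vector)] -/
theorem natCard_comap_eq :
    Nat.card (N.plus.comap (AddSubgroup.inclusion (geomTorsion_le_geomPrimaryTorsion W p))) =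
      Nat.card ↥(N.plus ⊓ AddSubgroup.torsionBy (↥(W.geomPrimaryTorsion p)) (p : ℤ)) := by
  refine Nat.card_congr
    { toFun := fun P ↦ ⟨AddSubgroup.inclusion (geomTorsion_le_geomPrimaryTorsion W p) P.1,
        ⟨P.2, ?_⟩⟩
      invFun := fun m ↦ ⟨⟨((m : W.geomPrimaryTorsion p) : W.geomPoints), ?_⟩, ?_⟩
      left_inv := fun P ↦ rfl
      right_inv := fun m ↦ rfl }
  · -- `p`-torsion
    exact (mem_torsionBy_primary_iff W p _).mpr (AddSubgroup.torsionBy.nsmul_iff.mp P.1.2)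
  · exact AddSubgroup.torsionBy.nsmul_iff.mpr ((mem_torsionBy_primary_iff W p m.1).mp m.2.2)
  · exact m.2.1

omit [W.IsElliptic] [W.IsGloballyMinimal] hp in
/-- **`hgen` read inside `E[p]`**: if every point of `M⁺ ∩ E[p^∞][p]` is `τ • c' − c'` with
`τ ∈ I_v`, `c'` in the same group (gen 9 `tateDatum_hgen`), and `X₀ ≠ 0`, then some `τ ∈ I_v` MOVES a
point of `X₀`. [cite: GreenbergVatsal2000, §2 pp. 14–15 and p. 26] -/
theorem exists_mem_inertia_smul_ne_of_hgen
    (hgen : ∀ c ∈ (GreenbergVatsalTorsion.torsionDatum N p).plus, ∃ τ ∈ inertia v,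
      ∃ c' ∈ (GreenbergVatsalTorsion.torsionDatum N p).plus, τ • c' - c' = c)
    {P : geomTorsion W (p : ℤ)}
    (hP : P ∈ N.plus.comap (AddSubgroup.inclusion (geomTorsion_le_geomPrimaryTorsion W p)))
    (hP0 : P ≠ 0) :
    ∃ τ ∈ inertia (K := ℚ) v, ∃ Q ∈ N.plus.comap
      (AddSubgroup.inclusion (geomTorsion_le_geomPrimaryTorsion W p)), τ • Q ≠ Q := by
  -- `P` as an element `c` of `E[p^∞][p]` lying in `M⁺`
  set m : W.geomPrimaryTorsion p :=
    AddSubgroup.inclusion (geomTorsion_le_geomPrimaryTorsion W p) P with hm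
  have hmp : m ∈ AddSubgroup.torsionBy (↥(W.geomPrimaryTorsion p)) (p : ℤ) :=
    (mem_torsionBy_primary_iff W p m).mpr (AddSubgroup.torsionBy.nsmul_iff.mp P.2)
  set c : AddSubgroup.torsionBy (↥(W.geomPrimaryTorsion p)) (p : ℤ) := ⟨m, hmp⟩ with hc
  have hcplus : c ∈ (GreenbergVatsalTorsion.torsionDatum N p).plus := by
    change (c : W.geomPrimaryTorsion p) ∈ N.plus
    exact hP
  obtain ⟨τ, hτ, c', hc', hτc'⟩ := hgen c hcplus
  -- `c'` as a point `Q ∈ X₀`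
  have hc'p : p • ((c' : W.geomPrimaryTorsion p) : W.geomPoints) = 0 :=
    (mem_torsionBy_primary_iff W p _).mp c'.2
  set Q : geomTorsion W (p : ℤ) :=
    ⟨((c' : W.geomPrimaryTorsion p) : W.geomPoints), AddSubgroup.torsionBy.nsmul_iff.mpr hc'p⟩
    with hQ
  have hQX : Q ∈ N.plus.comap (AddSubgroup.inclusion (geomTorsion_le_geomPrimaryTorsion W p)) := by
    rw [mem_comap_iff]
    have e : AddSubgroup.inclusion (geomTorsion_le_geomPrimaryTorsion W p) Q =
        (c' : W.geomPrimaryTorsion p) := Subtype.ext rfl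
    rw [e]
    exact hc'
  refine ⟨τ, hτ, Q, hQX, fun hfix ↦ hP0 ?_⟩
  -- if `τ • Q = Q` then `c = τ c' − c' = 0`, i.e. `P = 0`
  have hval : ((τ • c' - c' : AddSubgroup.torsionBy (↥(W.geomPrimaryTorsion p)) (p : ℤ)) :
      W.geomPrimaryTorsion p) = 0 := by
    apply Subtype.ext
    have h1 : ((τ • Q : geomTorsion W (p : ℤ)) : W.geomPoints) = (Q : W.geomPoints) := by rw [hfix]
    rw [AddSubgroup.torsionBy.coe_smul] at h1
    simp only [AddSubgroupClass.coe_sub, AddSubgroup.torsionBy.coe_smul, primaryComponent.coe_smul,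
      ZeroMemClass.coe_zero]
    rw [sub_eq_zero]
    exact h1
  rw [hτc'] at hval
  have hm0 : m = 0 := by
    have : (c : W.geomPrimaryTorsion p) = 0 := hval
    exact this
  apply Subtype.ext
  have h0 := congrArg (fun x : W.geomPrimaryTorsion p ↦ (x : W.geomPoints)) hm0
  simp only [hm, AddSubgroup.coe_inclusion, ZeroMemClass.coe_zero] at h0
  rw [ZeroMemClass.coe_zero]
  exact h0

end Line

/-! ## §2. A line meets `X₀` trivially or equals it -/

end Literature.NumberTheory.EllipticCurves.RibetGoodLattice.TateLineDecomposition

end Part7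

/-!
## Part 8 — port of `Summits/BirchSwinnertonDyer/Rank1Residual/X2/IsogenyLineType.lean` (2 declarations kept)

# GV CASE 2 ⟹ CASE 1 along the quotient isogeny at `p ‖ N`: the image of an unramified-odd kernel
# line is a RAMIFIED-EVEN rational line (cell `b2b-bsdres`, unit `b2b-bsdres-eisenstein-p2`, gen 18)

WHY (X2-GAP §22.6 (iii): GV CASE 2). The Greenberg–Vatsal parity hypothesis `GVPar W p` has two
cases: a rational line `Φ₀ ≤ E[p]` which is (1) ramified at `p` and even, or (2) unramified at `p`
and odd. Gens 16–17 derived the `λ/μ` clause of the flag `GV00-mult-asserted` in CASE 1 (modulo two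
typed printed inputs). GV p. 28 reduce CASE 2 to CASE 1 by the `p`-isogeny `E → E' = E/Φ₀`: the
image line `E[p]/Φ₀ ⊂ E'[p]` has the complementary character `ψ = ωφ⁻¹`, ramified at `p` and even.
This file proves that step at a MULTIPLICATIVE prime `p ‖ N` (`p` odd), where the local input is
the TATE LINE `C[p] ≅ μ_p` (inertia acts on `E[p]` through `(ω *; 0 1)`):

* §1 `isRationalLine_range_and_ramified_even_of_ker` — pure Galois modules: for an equivariant
  `g : E[p] → E'[p]` with kernel a line `K` UNRAMIFIED at `p` and ODD, the image `g(E[p])` is a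
  rational line RAMIFIED at `p` and EVEN, granted (hL₀) a line `L ≤ E[p]` at ONE prime `𝔓 ∣ p` with
  `(σ − 1)E[p] ⊆ L` for `σ ∈ I_𝔓` and a point of `L` moved by `I_𝔓`, and (hc) the two signs of
  complex conjugation (x1a's `gvPar_of_ker_line` argument, which only recorded `GVPar W' p`);
* §2 `exists_tateLine_adicCompletionPrime` — (hL₀) at an odd `p ‖ N` from gens 9/13's Tate data
  (`exists_data_of_split` / `exists_data_of_not_split`: `I_p` trivial on `E[p^∞]/C`, `I_p` moves
  `C[p]`, `#C[p] = p`), read at `𝔓₀ = adicCompletionPrime ℚ v` through Neukirch II (9.6)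
  (`inertia_adicCompletionPrime_eq_map_absInertia`); inputs: the Tate uniformisation named facts
  A40/A41 (`hT`, `hT'`), as everywhere in the X2 kernel;
* §3 `exists_rationalLine_ramified_even_of_isogeny` — for `E/ℚ` globally minimal, `p ≠ 2`
  multiplicative, `Φ₀` a rational line unramified at `p` and odd, and a `ℚ`-isogeny `g : E → E'`
  with `ker g = Φ₀`: `E'` has a rational line RAMIFIED at `p` and EVEN ((hc) by the Weil pairing,
  `exists_fixed_and_antifixed_of_isComplexConjugation`).

References: [GreenbergVatsal2000] §2 p. 28, pp. 14–15; [SerreInventiones1972] §1.11;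
[SilvermanATAEC1994] V.5.3, V.5.4; HOME/b2b-bsdres-eisenstein-p2/X2-GAP.md §23.
-/

section Part8

set_option autoImplicit false

open scoped _root_.Classical AddSubgroup

open _root_.WeierstrassCurve Literature.NumberTheory.EllipticCurves Literature.NumberTheory.GaloisRepresentations
  _root_.Field _root_.IsDedekindDomain _root_.NumberField Literature.NumberTheory.EllipticCurves.GreenbergSelmer
  Literature.NumberTheory.EllipticCurves.Rank1Residual
  Literature.NumberTheory.EllipticCurves.RibetGoodLattice.GreenbergVatsalTorsion
  Literature.NumberTheory.EllipticCurves.RibetGoodLattice.GreenbergVatsalTateDatumCofree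

namespace Literature.NumberTheory.EllipticCurves.RibetGoodLattice.IsogenyLineType

variable {W W' : WeierstrassCurve ℚ} {p : ℕ} [hp : Fact p.Prime]

/-! ## §1. Galois modules: the image of an unramified-odd kernel line is a ramified-even line -/

section KernelLine

variable (g : geomTorsion W (p : ℤ) →+ geomTorsion W' (p : ℤ))
  (hg : ∀ (σ : absoluteGaloisGroup ℚ) (P : geomTorsion W (p : ℤ)), g (σ • P) = σ • g P)

end KernelLine

/-! ## §2. The Tate line at an odd `p ‖ N`, in `𝔓.inertia` form (hL₀) -/

section TateLine

variable (W p) [W.IsElliptic] [W.IsGloballyMinimal]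

omit [W.IsElliptic] [W.IsGloballyMinimal] in
/-- From a Greenberg datum `N` on `E[p^∞]` above `v ∣ p` with inertially trivial graded piece
(`htriv`), inertially generated residual line (`hgen`) and `#(N⁺ ∩ E[p^∞][p]) = p` (`hC`): the
line `X₀ = N⁺ ∩ E[p] ≤ E[p]` has order `p`, `(σ - 1)E[p] ⊆ X₀` for every `σ` in the inertia group
of `𝔓₀ = adicCompletionPrime ℚ v` (Neukirch II (9.6), tree
`inertia_adicCompletionPrime_eq_map_absInertia`), and some such `σ` moves a point of `X₀`.
[cite: GreenbergVatsal2000, §2 pp. 14–15 and p. 26] -/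
theorem exists_line_adicCompletionPrime_of_datum {v : HeightOneSpectrum (𝓞 ℚ)}
    (hv : ((p : ℕ) : 𝓞 ℚ) ∈ v.asIdeal) (N : LocalDatum ℚ (W.geomPrimaryTorsion p) v)
    (htriv : ∀ x ∈ inertia v, ∀ m : W.geomPrimaryTorsion p, x • m - m ∈ N.plus)
    (hgen : ∀ c ∈ (torsionDatum N p).plus, ∃ τ ∈ inertia v,
      ∃ c' ∈ (torsionDatum N p).plus, τ • c' - c' = c)
    (hC : Nat.card ↥(N.plus ⊓ (↥(W.geomPrimaryTorsion p))[(p : ℤ)]) = p) :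
    ∃ L : AddSubgroup (geomTorsion W (p : ℤ)), Nat.card L = p ∧
      (∀ σ ∈ (adicCompletionPrime ℚ v).inertia (absoluteGaloisGroup ℚ),
        ∀ P : geomTorsion W (p : ℤ), σ • P - P ∈ L) ∧
      (∃ σ ∈ (adicCompletionPrime ℚ v).inertia (absoluteGaloisGroup ℚ), ∃ P ∈ L, σ • P ≠ P) := by
  have _ := hv
  set X : AddSubgroup (geomTorsion W (p : ℤ)) :=
    N.plus.comap (AddSubgroup.inclusion (geomTorsion_le_geomPrimaryTorsion W p)) with hX
  have hXcard : Nat.card X = p := by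
    rw [hX, TateLineDecomposition.natCard_comap_eq W p N, hC]
  refine ⟨X, hXcard, ?_, ?_⟩
  · intro σ hσ P
    rw [inertia_adicCompletionPrime_eq_map_absInertia] at hσ
    rw [hX, TateLineDecomposition.mem_comap_iff, map_sub, TateLineDecomposition.inclusion_smul]
    exact htriv σ hσ _
  · -- a non-zero point of `X` (order `p > 1`), moved by some inertia element (`hgen`)
    haveI : Finite X := Nat.finite_of_card_ne_zero (by rw [hXcard]; exact hp.out.ne_zero)
    have h1 : 1 < Nat.card X := by rw [hXcard]; exact hp.out.one_lt
    obtain ⟨P, hPX, hP0⟩ : ∃ P ∈ X, P ≠ 0 := by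
      by_contra h
      push Not at h
      have : Nat.card X = 1 := by
        rw [Nat.card_eq_one_iff_exists]
        exact ⟨⟨0, X.zero_mem⟩, fun ⟨Q, hQ⟩ ↦ Subtype.ext (h Q hQ)⟩
      omega
    obtain ⟨τ, hτ, Q, hQ, hne⟩ :=
      TateLineDecomposition.exists_mem_inertia_smul_ne_of_hgen W p N hgen hPX hP0
    refine ⟨τ, ?_, Q, hQ, hne⟩
    rw [inertia_adicCompletionPrime_eq_map_absInertia]
    exact hτ

end TateLine

/-! ## §3. Assembly: CASE 2 for `E` gives CASE 1 for `E/Φ₀` -/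

section Assembly

variable [W.IsElliptic] [W.IsGloballyMinimal]

omit hp [W.IsElliptic] [W.IsGloballyMinimal] in
/-- The restriction of a `ℚ`-isogeny to the `p`-torsion, `g : E[p] →+ E'[p]` (values and
equivariance). [cite: GreenbergVatsal2000, §2 p. 28 (reduction to φ ramified and even: a rational p-line of the datum at the completion)] -/
theorem exists_restrict_torsion (f : Isogeny W W') :
    ∃ g : geomTorsion W (p : ℤ) →+ geomTorsion W' (p : ℤ),
      (∀ P : geomTorsion W (p : ℤ), (g P : geomPoints W') = f (P : geomPoints W)) ∧
      (∀ (σ : absoluteGaloisGroup ℚ) (P : geomTorsion W (p : ℤ)), g (σ • P) = σ • g P) := by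
  have hmem : ∀ P : geomTorsion W (p : ℤ), f (P : geomPoints W) ∈ geomTorsion W' (p : ℤ) := by
    intro P
    have h0 : (p : ℤ) • (P : geomPoints W) = 0 := (Submodule.mem_torsionBy_iff (p : ℤ) _).mp P.2
    have h1 : (p : ℤ) • f (P : geomPoints W) = 0 := by rw [← map_zsmul, h0, map_zero]
    exact (Submodule.mem_torsionBy_iff (p : ℤ) _).mpr h1
  let g : geomTorsion W (p : ℤ) →+ geomTorsion W' (p : ℤ) :=
    { toFun := fun P ↦ ⟨f (P : geomPoints W), hmem P⟩
      map_zero' := Subtype.ext (by simp)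
      map_add' := fun P Q ↦ Subtype.ext (by simp) }
  have hgval : ∀ P : geomTorsion W (p : ℤ), (g P : geomPoints W') = f (P : geomPoints W) :=
    fun _ ↦ rfl
  refine ⟨g, hgval, fun σ P ↦ ?_⟩
  apply Subtype.ext
  rw [hgval, AddSubgroup.torsionBy.coe_smul, AddSubgroup.torsionBy.coe_smul, hgval, f.map_smul]

end Assembly

end Literature.NumberTheory.EllipticCurves.RibetGoodLattice.IsogenyLineType

end Part8

/-!
## Part 9 — port of `Summits/BirchSwinnertonDyer/Rank1Residual/X2/IsogenyQuotientLine.lean` (1 declarations kept)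

# The quotient of `E/ℚ` by a rational `p`-isogeny kernel, on a globally minimal model, and the
# transports along it at a multiplicative prime (cell `b2b-bsdres`, unit `b2b-bsdres-eisenstein-p2`, gen 18)

WHY (X2-GAP §22.3/§22.6 (iii): GV CASE 2). Greenberg–Vatsal, Invent. Math. 142 (2000), p. 28,
treat the parity case "`φ` unramified at `p` and odd" of their Thm. (1.3) by passing to the
`p`-isogenous curve `E' = E/Φ`, for which the image line `E[p]/Φ` is ramified at `p` and even
("A result of Schneider then implies that the `μ`-invariant … is unchanged by a `p`-isogeny. The
`λ`-invariant is always unchanged by an isogeny. Thus, we may assume … `φ` is ramified and even").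
This file supplies the curve `E'` in the tree's vocabulary, as the first step of the kernel version
of that reduction at a multiplicative prime `p ‖ N` (sequel files: `X2/IsogenyLineType.lean` — the
image line is ramified-even; `X2/GreenbergVatsalIsogenyReduction.lean` — the rank-`0` closure of
sub-cell X2a without the flag `GV00-mult-asserted`):

* `exists_isogeny_ker_eq_line` — for a rational line `Φ₀ ≤ E[p]` (order `p`, `Γ_ℚ`-stable) there are
  an elliptic curve over `ℚ` with a GLOBALLY MINIMAL model `W'` and a `ℚ`-isogeny `g : E → E'` with
  `ker g = Φ₀` on `ℚ̄`-points and `deg g = p` (Silverman *AEC* III.4.12 + Rem. III.4.13.2, tree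
  theorem `exists_isogeny_ker_eq_and_comp_eq_nsmul_holds`; Néron's global minimal model over `ℚ`,
  tree theorem `hasGlobalMinimalModel_rat_holds`; the change of variables as an isogeny,
  `VariableChange.toIsogeny`);
* `hasMultiplicativeReductionAtPrime_of_isIsogenous`,
  `hasSplitMultiplicativeReductionAtPrime_of_isIsogenous`, `…_iff_of_isIsogenous` — multiplicative
  and split multiplicative reduction at `p` are `ℚ`-isogeny invariants, in the `ℚ`-prime vocabulary
  of class X2 (`HasMultiplicativeReductionAtPrime`, `HasSplitMultiplicativeReductionAtPrime`), read
  off the tree's place-wise theorems (*AEC* VII.7.2 / §C.16: `a_p = ±1` and `a_p(E) = a_p(E')`).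

References: [GreenbergVatsal2000] §2 p. 28; [SilvermanAEC2009] III.4.12, III.4.13.2, VII.7.2,
VIII.8.3, §C.16; HOME/b2b-bsdres-eisenstein-p2/X2-GAP.md §23.
-/

section Part9

set_option autoImplicit false

open scoped _root_.Classical

open _root_.WeierstrassCurve Literature.NumberTheory.EllipticCurves
  Literature.NumberTheory.EllipticCurves.ModularForms Literature.NumberTheory.EllipticCurves.Rank1Residual
  _root_.Field _root_.IsDedekindDomain _root_.NumberField

namespace Literature.NumberTheory.EllipticCurves.RibetGoodLattice.IsogenyQuotientLine

variable {W : WeierstrassCurve ℚ} [W.IsElliptic] {p : ℕ} [hp : Fact p.Prime]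

/-! ## §1. The quotient isogeny `E → E/Φ₀` onto a globally minimal model -/

omit [W.IsElliptic] in
/-- The rational line `Φ₀ ≤ E[p]` pushed into `E(ℚ̄)` has order `p`. [cite: SilvermanAEC2009, Prop. III.4.12 with Rem. III.4.13.2 (cardinality of the image of a finite subgroup under an isogeny)] -/
theorem natCard_map_subtype {Φ₀ : AddSubgroup (geomTorsion W (p : ℤ))}
    (hΦ : IsRationalLine W p Φ₀) :
    Nat.card (Φ₀.map (geomTorsion W (p : ℤ)).subtype) = p := by
  have h := Nat.card_congr
    (Φ₀.equivMapOfInjective (geomTorsion W (p : ℤ)).subtype Subtype.val_injective).toEquiv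
  rw [← h]
  exact hΦ.1

section Transport

variable {W' : WeierstrassCurve ℚ} [W'.IsElliptic]

end Transport

end Literature.NumberTheory.EllipticCurves.RibetGoodLattice.IsogenyQuotientLine

end Part9

/-!
## Part 10 — port of `Summits/BirchSwinnertonDyer/Rank1Residual/X2/GreenbergVatsalReductionDatumCard.lean` (2 declarations kept)

# `#(C_p ∩ E[p^∞][p]) = p` for GREENBERG'S REDUCTION DATUM at a good ORDINARY prime of `E/ℚ`
# (cell `b2b-bsdres`, unit `b2b-bsdres-eisenstein-p2`, gen 19; X2-GAP §21.6 (iii): the brick that lets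
# the gen-16 residual devissage — GV display (16) — run VERBATIM at a good ordinary Eisenstein prime)

WHAT. Gen 9 built Greenberg's datum `C_v = ker(E[p^∞] → Ẽ(k̄_v))` at a good prime `v ∋ p`
(`GreenbergVatsalReductionDatum.reductionDatum`) and discharged "`I_p` trivial on `D`" and the Kummer
compatibility; gen 9/`…ReductionDatumLine` discharged `hgen`. The one structural input of the gen-16
devissage (`ResidualDevissageLine.natCard_gvSelmer_torsion_eq_mul_of_line`, hypothesis `hcard`) and of
gen 13's counts (`exists_data_count_of_*`, clause `#(C ∩ E[p^∞][p]) = p`) that was proved only for the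
TATE datum (`GreenbergVatsalTateDatumCofree.natCard_tateDatum_plus_inf_torsionBy`) is proved here for
the reduction datum: at a good ORDINARY `p` (`p ∤ a_p`), `C_v[p]` is cyclic of order `p` — Greenberg's
"`ℱ[p^∞] ≅ ℚ_p/ℤ_p`" (LNM 1716 §1 p. 62, §2 p. 70), Greenberg–Vatsal's "`d⁺ = 1`" (p. 14) — from the
tree's ordinary filtration on `E(K̄_v)` (`OrdinaryLocalReductionMapProofs.localRed_ordinary_filtration`:
`(ker red_v)[p^r]` is generated by one point of order `p^r`) and the algebraicity of torsion
(`GreenbergVatsalTateDatumCofree.exists_primaryTorsion_pointsMap_eq`).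

* `natCard_reductionDatum_plus_inf_torsionBy` — `Nat.card (C_v ⊓ E[p^∞][p]) = p`;
* `natCard_reductionData_plus_inf_torsionBy` — the same for the data `reductionData W p hΔ` (the
  shape of the clause `hC`/`hcard` consumed by gens 13/16).

References: Greenberg, LNM 1716 (1999) §1 p. 62, §2 p. 70; Greenberg–Vatsal 2000 §2 p. 14;
Silverman *AEC* VII.2.1, III.6.4; HOME/b2b-bsdres-eisenstein-p2/X2-GAP.md §21.6 (iii), §24.
-/

section Part10

open scoped _root_.Classical AddSubgroup _root_.NNReal

open _root_.NumberField _root_.IsDedekindDomain _root_.Field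
open Literature.NumberTheory.EllipticCurves Literature.NumberTheory.EllipticCurves.GreenbergSelmer
  Literature.NumberTheory.GaloisRepresentations _root_.IsDedekindDomain.HeightOneSpectrum
  Literature.NumberTheory.EllipticCurves.RibetGoodLattice.GreenbergVatsalTorsion
open _root_.WeierstrassCurve (minimalDiscriminantInt integralModelInt)

universe u

namespace Literature.NumberTheory.EllipticCurves.RibetGoodLattice.GreenbergVatsalReductionDatum

variable (W : WeierstrassCurve ℚ) [W.IsGloballyMinimal] [W.IsElliptic] (p : ℕ) [hp : Fact p.Prime]
  {v : HeightOneSpectrum (𝓞 ℚ)}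

/-- **`#(C_v ∩ E[p^∞][p]) = p` at a good ORDINARY prime** (`p ∤ Δ_E`, `p ∤ a_p`): the `p`-torsion
of Greenberg's datum `C_v = ker(E[p^∞] → Ẽ(k̄_v))` has exactly `p` elements. Proof: the ordinary
filtration (`localRed_ordinary_filtration`, from the ordinary point `exists_zsmul_eq_zero_localRed_ne_zero`)
gives a point `P₁ ∈ ker red_v` of order `p` such that every `P ∈ ker red_v` with `pP = 0` is a
multiple of `P₁`; `P₁ = ι m₁` for some `m₁ ∈ E[p^∞](ℚ̄)` (torsion is algebraic), and `c ↦ c·m₁`,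
`ℤ/p → C_v ⊓ E[p^∞][p]`, is a bijection (`ι` injective). This is Greenberg's `ℱ[p^∞] ≅ ℚ_p/ℤ_p` at the
level `p` / Greenberg–Vatsal's "`d⁺ = 1`" for the good-ordinary datum.
[cite: GreenbergLNM1716, §1 p. 62 and §2 p. 70] [cite: GreenbergVatsal2000, §2 p. 14]
[cite: SilvermanAEC2009, Prop. VII.2.1 and Cor. III.6.4] -/
theorem natCard_reductionDatum_plus_inf_torsionBy (hpv : ((p : ℕ) : 𝓞 ℚ) ∈ v.asIdeal)
    (hΔ : ¬ (p : ℤ) ∣ minimalDiscriminantInt W) (hord : ¬ (p : ℤ) ∣ W.frobeniusTrace p) :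
    Nat.card ↥((reductionDatum W p hpv hΔ).plus ⊓ (↥(W.geomPrimaryTorsion p))[(p : ℤ)]) = p := by
  -- residue characteristic `p` and the ordinary point (as in `GreenbergVatsalStrictAtPQuotient`)
  have hΔu := W.isUnit_Δ_localIntModel hpv (specVal_spec v) hΔ
  have hvO : (specVal v).Integers (specVal v).valuationSubring :=
    Valuation.valuationSubring.integers (specVal v)
  have hpO : specVal v ((p : ℕ) : AlgebraicClosure (v.adicCompletion ℚ)) < 1 := by
    have h := IsDedekindDomain.HeightOneSpectrum.spectralValuation_algebraMap_ringOfIntegers_lt_one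
      (v := v) (specVal_spec v) hpv
    rwa [map_natCast] at h
  haveI hchar : CharP (IsLocalRing.ResidueField ↥(specVal v).valuationSubring) p := by
    refine (CharP.charP_iff_prime_eq_zero hp.out).mpr ?_
    rw [← map_natCast (IsLocalRing.residue ↥(specVal v).valuationSubring),
      IsLocalRing.residue_eq_zero_iff, IsLocalRing.mem_maximalIdeal, mem_nonunits_iff,
      hvO.isUnit_iff_valuation_eq_one]
    exact fun h ↦ absurd h (ne_of_lt (by simpa using hpO))
  have hordA := W.exists_zsmul_eq_zero_localRed_ne_zero (specVal_spec v) hΔu (localRed W p hpv hΔ)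
    (fun _ ↦ rfl) hpv hΔ hord
  obtain ⟨hgenr, -, -⟩ := W.localRed_ordinary_filtration hΔu (localRed W p hpv hΔ) (fun _ ↦ rfl)
    hordA
  obtain ⟨P₁, hP₁red, hP₁ord, hP₁gen⟩ := hgenr 1
  rw [pow_one] at hP₁ord
  have hpP₁ : p • P₁ = 0 := by rw [← hP₁ord]; exact addOrderOf_nsmul_eq_zero P₁
  -- lift the generator to `E[p^∞](ℚ̄)`
  obtain ⟨m₁, hm₁⟩ := GreenbergVatsalTateDatumCofree.exists_primaryTorsion_pointsMap_eq W p P₁ 1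
    (by rw [pow_one]; exact hpP₁)
  have hinj := GreenbergVatsalTateDatumCofree.pointsMap_coe_injective W p (v := v)
  have hm₁C : m₁ ∈ (reductionDatum W p hpv hΔ).plus := by
    rw [mem_reductionDatum_plus_iff, hm₁]; exact hP₁red
  have hm₁p : m₁ ∈ (↥(W.geomPrimaryTorsion p))[(p : ℤ)] := by
    rw [AddSubgroup.torsionBy, Submodule.mem_toAddSubgroup, Submodule.mem_torsionBy_iff]
    change (p : ℤ) • m₁ = 0
    rw [natCast_zsmul]
    apply hinj
    change pointsMap W (v.adicCompletion ℚ) ((p • m₁ : W.geomPrimaryTorsion p) : W.geomPoints) =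
      pointsMap W (v.adicCompletion ℚ) ((0 : W.geomPrimaryTorsion p) : W.geomPoints)
    rw [AddSubmonoidClass.coe_nsmul, map_nsmul, hm₁, hpP₁, ZeroMemClass.coe_zero, map_zero]
  -- multiples of `m₁` map to multiples of `P₁`
  have hmul : ∀ c : ℕ, pointsMap W (v.adicCompletion ℚ)
      ((c • m₁ : W.geomPrimaryTorsion p) : W.geomPoints) = c • P₁ := fun c ↦ by
    rw [AddSubmonoidClass.coe_nsmul, map_nsmul, hm₁]
  -- the bijection `ℤ/p → C_v ⊓ E[p^∞][p]`
  let f : ZMod p → ↥((reductionDatum W p hpv hΔ).plus ⊓ (↥(W.geomPrimaryTorsion p))[(p : ℤ)]) :=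
    fun c ↦ ⟨c.val • m₁, AddSubgroup.mem_inf.2
      ⟨AddSubgroup.nsmul_mem _ hm₁C _, AddSubgroup.nsmul_mem _ hm₁p _⟩⟩
  have hf : Function.Bijective f := by
    constructor
    · intro c c' h
      have h1 : (c.val • m₁ : W.geomPrimaryTorsion p) = c'.val • m₁ := congrArg Subtype.val h
      have h2 : c.val • P₁ = c'.val • P₁ := by
        rw [← hmul, ← hmul, h1]
      rw [nsmul_inj_mod, hP₁ord, Nat.mod_eq_of_lt (ZMod.val_lt c),
        Nat.mod_eq_of_lt (ZMod.val_lt c')] at h2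
      exact ZMod.val_injective p h2
    · rintro ⟨x, hx⟩
      obtain ⟨hxC, hxp⟩ := AddSubgroup.mem_inf.1 hx
      have hpx : (p : ℤ) • x = 0 := by
        have h := hxp
        rw [AddSubgroup.torsionBy, Submodule.mem_toAddSubgroup, Submodule.mem_torsionBy_iff] at h
        exact h
      have hred : localRed W p hpv hΔ (pointsMap W (v.adicCompletion ℚ) (x : W.geomPoints)) = 0 :=
        (mem_reductionDatum_plus_iff W p hpv hΔ x).1 hxC
      have hpx' : ((p ^ 1 : ℕ) : ℤ) • pointsMap W (v.adicCompletion ℚ) (x : W.geomPoints) = 0 := by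
        rw [pow_one, ← map_zsmul, ← AddSubgroupClass.coe_zsmul, hpx, ZeroMemClass.coe_zero, map_zero]
      obtain ⟨c, hc⟩ := hP₁gen _ hred hpx'
      refine ⟨(c : ZMod p), Subtype.ext ?_⟩
      change ((c : ZMod p).val • m₁ : W.geomPrimaryTorsion p) = x
      apply hinj
      change pointsMap W (v.adicCompletion ℚ)
          ((((c : ZMod p).val • m₁ : W.geomPrimaryTorsion p)) : W.geomPoints) =
        pointsMap W (v.adicCompletion ℚ) (x : W.geomPoints)
      rw [hmul, ZMod.val_natCast, hc]
      -- `(c % p) • P₁ = c • P₁` since `p • P₁ = 0`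
      conv_rhs => rw [← Nat.mod_add_div c p]
      rw [add_nsmul, mul_nsmul, hpP₁, nsmul_zero, add_zero]
  rw [← Nat.card_eq_of_bijective f hf, Nat.card_zmod]

/-- The same for Greenberg's DATA above `p` (`reductionData W p hΔ`): the clause
`∀ v ∋ p, #(C_v ⊓ E[p^∞][p]) = p` in the shape consumed by gen 13's counts (`hC`) and gen 16's
devissage (`hcard`). [cite: GreenbergLNM1716, §1 p. 62 and §2 p. 70] [cite: GreenbergVatsal2000, §2 p. 14] -/
theorem natCard_reductionData_plus_inf_torsionBy (hΔ : ¬ (p : ℤ) ∣ minimalDiscriminantInt W)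
    (hord : ¬ (p : ℤ) ∣ W.frobeniusTrace p) :
    ∀ (v : HeightOneSpectrum (𝓞 ℚ)) (hv : ((p : ℕ) : 𝓞 ℚ) ∈ v.asIdeal),
      Nat.card ↥((reductionData W p hΔ v hv).plus ⊓ (↥(W.geomPrimaryTorsion p))[(p : ℤ)]) = p :=
  fun _ hv ↦ natCard_reductionDatum_plus_inf_torsionBy W p hv hΔ hord

end Literature.NumberTheory.EllipticCurves.RibetGoodLattice.GreenbergVatsalReductionDatum

end Part10

/-!
## Part 11 — port of `Summits/BirchSwinnertonDyer/Rank1Residual/X2/IsogenyLineTypeGoodOrdinary.lean` (1 declarations kept)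

# GV CASE 2 ⟹ CASE 1 along the quotient isogeny at a GOOD ORDINARY prime: the image of an
# unramified-odd kernel line is a RAMIFIED-EVEN rational line — the local input is Greenberg's
# REDUCTION LINE `C_p[p] = ker(E[p] → Ẽ[p])` (cell `b2b-bsdres`, unit `b2b-bsdres-eisenstein-p2`,
# gen 20; the printed setting of GV Thm. (1.3), X2-GAP §24.6 3(i))

WHY. Gen 18 (`X2/IsogenyLineType`) performed Greenberg–Vatsal's reduction of CASE 2 of the parity
hypothesis (rational line `Φ₀` UNRAMIFIED at `p` and ODD) to CASE 1 (line RAMIFIED and EVEN) along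
the `p`-isogeny `E → E' = E/Φ₀` (GV p. 28) at a MULTIPLICATIVE prime, where the local input (hL₀)
was the TATE LINE. Its Galois-module core `isRationalLine_range_and_ramified_even_of_ker` is
reduction-type free: it needs, at ONE prime `𝔓 ∣ p`, a line `L ≤ E[p]` with `(σ − 1)E[p] ⊆ L` for
`σ ∈ I_𝔓` and a point of `L` moved by `I_𝔓`. At a GOOD ORDINARY prime this line is Greenberg's
REDUCTION LINE `C_p[p]`, `C_p = ker(E[p^∞] → Ẽ(𝔽̄_p))`: `I_p` acts trivially on `E[p^∞]/C_p` (gen 9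
`reductionData_htriv`), `I_p` moves every point of `C_p[p] ≅ μ_p` (gen 9
`reductionData_hgen`, via the Weil pairing and local Kronecker–Weber), `#C_p[p] = p` (gen 19
`natCard_reductionData_plus_inf_torsionBy`, ordinarity). So:

* §1 `exists_reductionLine_adicCompletionPrime` — (hL₀) at an odd good ordinary prime;
* §2 `exists_rationalLine_ramified_even_of_isogeny_goodOrd` — `E` CASE 2 ⟹ `E/Φ₀` CASE 1 at a
  good ordinary prime (signs of complex conjugation by the Weil pairing, as in gen 18);
* §3 transport along a `ℚ`-isogeny of the standing data at a good ordinary prime: good reduction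
  (Serre–Tate, tree `IsIsogenous.hasGoodReductionAtPrime_iff`), `a_p` (Faltings, tree
  `frobeniusTrace_eq_of_isIsogenous`), hence ordinarity and THE SAME unit root
  `unitRoot W p = unitRoot W' p` of `X² − a_p X + p` (so the Mazur–Swinnerton-Dyer `p`-adic
  `L`-functions `padicLFunction f α` of `E` and `E'` are built from the same `(f, α)`).

References: [GreenbergVatsal2000] §2 p. 28 (reduction to `φ` ramified and even), p. 26
("`C[p] = μ_p`"); [GreenbergLNM1716] §2 p. 70; HOME/b2b-bsdres-eisenstein-p2/X2-GAP.md §23, §25.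
-/

section Part11

set_option autoImplicit false

open scoped _root_.Classical AddSubgroup

open _root_.WeierstrassCurve Literature.NumberTheory.EllipticCurves Literature.NumberTheory.GaloisRepresentations
  _root_.Field _root_.IsDedekindDomain _root_.NumberField Literature.NumberTheory.EllipticCurves.GreenbergSelmer
  Literature.NumberTheory.EllipticCurves.Rank1Residual
  Literature.NumberTheory.EllipticCurves.RibetGoodLattice.GreenbergVatsalTorsion
  Literature.NumberTheory.EllipticCurves.RibetGoodLattice.GreenbergVatsalReductionDatum
  Literature.NumberTheory.EllipticCurves.RibetGoodLattice.GreenbergVatsalReductionDatumLine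
  Literature.NumberTheory.EllipticCurves.RibetGoodLattice.IsogenyLineType

namespace Literature.NumberTheory.EllipticCurves.RibetGoodLattice.IsogenyLineTypeGoodOrdinary

variable {W W' : WeierstrassCurve ℚ} {p : ℕ} [hp : Fact p.Prime]

/-! ## §1. The reduction line at an odd good ordinary prime, in `𝔓.inertia` form (hL₀) -/

section ReductionLine

variable (W p) [W.IsElliptic] [W.IsGloballyMinimal]

/-- **(hL₀) at an odd GOOD ORDINARY prime** (Greenberg's REDUCTION LINE): for `E/ℚ` globally
minimal with good ordinary reduction at the odd prime `p`, at the place `v` of `ℚ` above `p` and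
the prime `𝔓₀ = adicCompletionPrime ℚ v` of `\bar ℤ` there is a line `L ≤ E[p]` (`L = C_p[p]`,
`C_p = ker(E[p^∞] → Ẽ)`) of order `p` with `(σ − 1)E[p] ⊆ L` for all `σ ∈ I_{𝔓₀}` (the quotient
`Ẽ[p]` is unramified) and some `σ ∈ I_{𝔓₀}` moving a point of `L` (`C_p[p] ≅ μ_p` as an
`I_p`-module and `p` is odd — GV p. 26: "the subgroup `C[p]` of `A[p]` is determined by the action
of `I_p`: `C[p] = μ_p`"). Inputs: gen 9's reduction datum (`reductionData_htriv`), gen 9's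
`reductionData_hgen`, gen 19's `#C_p[p] = p` (`natCard_reductionData_plus_inf_torsionBy`), read at
`𝔓₀` by gen 18's `exists_line_adicCompletionPrime_of_datum`. No named fact.
[cite: GreenbergVatsal2000, §2 p. 26 and p. 28] [cite: GreenbergLNM1716, §2 p. 70] -/
theorem exists_reductionLine_adicCompletionPrime (hp2 : p ≠ 2)
    (hgood : W.HasGoodReductionAtPrime p) (hord : ¬ (p : ℤ) ∣ W.frobeniusTrace p) :
    ∃ (v : HeightOneSpectrum (𝓞 ℚ)), (p : 𝓞 ℚ) ∈ v.asIdeal ∧ ∃ 𝔓 ∈ v.primesAbove,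
      ∃ L : AddSubgroup (geomTorsion W (p : ℤ)), Nat.card L = p ∧
        (∀ σ ∈ 𝔓.inertia (absoluteGaloisGroup ℚ), ∀ P : geomTorsion W (p : ℤ), σ • P - P ∈ L) ∧
        (∃ σ ∈ 𝔓.inertia (absoluteGaloisGroup ℚ), ∃ P ∈ L, σ • P ≠ P) := by
  have hpP : p.Prime := hp.out
  have hΔ : ¬ (p : ℤ) ∣ minimalDiscriminantInt W :=
    W.not_dvd_minimalDiscriminantInt_of_hasGoodReductionAtPrime' p hgood
  obtain ⟨v, hv⟩ :=
    Literature.NumberTheory.NumberFields.RingOfIntegers.exists_heightOneSpectrum_natCast_mem ℚ hpP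
  refine ⟨v, hv, adicCompletionPrime ℚ v, adicCompletionPrime_mem_primesAbove ℚ v, ?_⟩
  exact exists_line_adicCompletionPrime_of_datum W p hv (reductionData W p hΔ v hv)
    (reductionData_htriv W p hΔ v hv) (reductionData_hgen W p hp2 hΔ hord v hv)
    (natCard_reductionData_plus_inf_torsionBy W p hΔ hord v hv)

end ReductionLine

/-! ## §2. CASE 2 for `E` gives CASE 1 for `E/Φ₀` at a good ordinary prime -/

section Assembly

variable [W.IsElliptic] [W.IsGloballyMinimal]

end Assembly

/-! ## §3. Transport of the good-ordinary data along a `ℚ`-isogeny -/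

section Transport

variable [W.IsElliptic] [W'.IsElliptic] [W.IsGloballyMinimal] [W'.IsGloballyMinimal]

end Transport

end Literature.NumberTheory.EllipticCurves.RibetGoodLattice.IsogenyLineTypeGoodOrdinary

end Part11

/-!
## Part 12 — port of `Summits/BirchSwinnertonDyer/Rank1Residual/X1/StableCyclicQuotient.lean` (7 declarations kept)

# `Γ_ℚ`-stable cyclic subgroups of an elliptic curve over `ℚ`: quotients onto globally minimal
# models, bounded order, and the image of `E[p]` modulo an unramified line

Cell `bsd-eis` (FULL-BSD rank-≤1 programme, row A1; home `run/shared/lean/pub/bsd-eis/`), seat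
`bsd-eis-ky` (prover, Keller–Yin verification) gen 3, memo `HOME/bsd-eis-ky-MEMO-3.md` §5 R2. This
file holds the KERNEL-PROVED ingredients of the existence of Keller–Yin's "good lattice" in every
isogeny class of class X1 (`X1/GoodLatticeExists.lean`, which discharges the cited fact
`Literature.NumberTheory.EllipticCurves.ribet_exists_isIsogenous_noUnramifiedLine`):

* §1 `isRationalLine_range_and_not_unramified_of_ker` — for an equivariant `g : E[p] → E'[p]` with
  `#E[p] = p²` whose kernel is an UNRAMIFIED line, at a prime `p` where `E` carries a reduction-line
  datum (good ordinary `p > 2`: `IsogenyLineTypeGoodOrdinary.exists_reductionLine_adicCompletionPrime`),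
  the image `g(E[p])` is a rational line of `E'` which is NOT unramified at `p` (parity-free variant of
  `IsogenyLineType.isRationalLine_range_and_ramified_even_of_ker`; same proof: the unramified kernel
  meets the ramified reduction line trivially, so the reduction line maps isomorphically onto the image).
* §2 `exists_minimal_isogeny_ker_eq` — quotient by a finite `Γ_ℚ`-stable subgroup onto a GLOBALLY
  MINIMAL model (Silverman *AEC* III.4.12 / Rem. III.4.13.2 = tree
  `exists_isogeny_ker_eq_and_comp_eq_nsmul_holds`, Néron VIII.8.3 = `hasGlobalMinimalModel_rat_holds`,
  `VariableChange.toIsogeny`); `degree_eq_addOrderOf_of_ker_eq`, `degree_cast`.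
* §3 `bddAbove_setOf_stableCyclic` — the orders `p^k` of `Γ_ℚ`-stable cyclic subgroups `ℤx ⊂ E(ℚ̄)`
  are BOUNDED: the quotients `E/ℤx` fall into the finitely many `ℚ`-isomorphism classes of the isogeny
  class (Shafarevich, *AEC* IX.6.2 = tree `finite_isogenyClass_holds`), and two cyclic `ℚ`-isogenies
  onto the same curve have equal degree (`degree_eq_of_isCyclic`, from `End_ℚ(E) = ℤ`).
* §4 `eq_of_prime_card_of_mem`, `exists_generator_of_prime_card` — subgroups of prime order.

Everything here is proved in the kernel from tree theorems; no named fact is taken as a hypothesis.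

## References
* [SilvermanAEC2009] J. H. Silverman, *The Arithmetic of Elliptic Curves*, 2nd ed., III.4.12,
  III.4.13.2, VIII.8.3, IX.6.2.
* [KellerYin2024] T. Keller, M. Yin, arXiv:2402.12781v2, Prop. 1.3.1, §1.4 (the good lattice).
* HOME/bsd-eis-ky-MEMO-3.md §5 R2 (plan of this proof).
-/

section Part12

set_option autoImplicit false

open scoped _root_.Classical

open _root_.WeierstrassCurve _root_.NumberField _root_.IsDedekindDomain Literature.NumberTheory.EllipticCurves
  Literature.NumberTheory.EllipticCurves.Rank1Residual Literature.NumberTheory.GaloisRepresentations _root_.Field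
  Literature.NumberTheory.EllipticCurves.RibetGoodLattice.IsogenyLineType
  Literature.NumberTheory.EllipticCurves.RibetGoodLattice.IsogenyLineTypeGoodOrdinary

namespace Literature.NumberTheory.EllipticCurves.RibetGoodLattice.StableCyclicQuotient

variable {W W' : WeierstrassCurve ℚ} {p : ℕ} [hp : Fact p.Prime]

/-! ## §1 The image of `E[p]` modulo an UNRAMIFIED line is a RAMIFIED rational line (parity-free) -/

omit hp in
/-- Two subgroups of the same prime order sharing a non-zero element coincide (each is generated by
that element). [cite: SilvermanAEC2009, Prop. III.4.12 with Rem. III.4.13.2 and Cor. IX.6.2 (Galois-stable cyclic subgroups, quotient isogenies, Shafarevich finiteness of the isogeny class)] -/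
theorem eq_of_prime_card_of_mem {A : Type*} [AddCommGroup A] {p : ℕ} [Fact p.Prime]
    {H₁ H₂ : AddSubgroup A} (h₁ : Nat.card H₁ = p) (h₂ : Nat.card H₂ = p) {x : A} (hx0 : x ≠ 0)
    (hx₁ : x ∈ H₁) (hx₂ : x ∈ H₂) : H₁ = H₂ := by
  have hp : p.Prime := Fact.out
  -- the order of `x` is `p`
  have hord : addOrderOf x = p := by
    haveI : Finite H₁ := Nat.finite_of_card_ne_zero (by rw [h₁]; exact hp.ne_zero)
    have hdvd : addOrderOf (⟨x, hx₁⟩ : H₁) ∣ p := by rw [← h₁]; exact addOrderOf_dvd_natCard _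
    rw [AddSubgroup.addOrderOf_mk] at hdvd
    rcases (Nat.dvd_prime hp).mp hdvd with h | h
    · exact absurd (AddMonoid.addOrderOf_eq_one_iff.mp h) hx0
    · exact h
  have key : ∀ {H : AddSubgroup A}, Nat.card H = p → x ∈ H → AddSubgroup.zmultiples x = H := by
    intro H hH hxH
    haveI : Finite H := Nat.finite_of_card_ne_zero (by rw [hH]; exact hp.ne_zero)
    exact AddSubgroup.eq_of_le_of_card_ge ((AddSubgroup.zmultiples_le_of_mem hxH))
      (by rw [hH, Nat.card_zmultiples, hord])
  rw [← key h₁ hx₁, key h₂ hx₂]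

/-- **Parity-free half of `IsogenyLineType.isRationalLine_range_and_ramified_even_of_ker`.** Let
`g : E[p] → E'[p]` be `Γ_ℚ`-equivariant with kernel of order `p` UNRAMIFIED at `p`, `#E[p] = p²`, and
suppose (hL₀) that at some prime `𝔓 ∣ p` there is a line `L ≤ E[p]` with `(σ − 1)E[p] ⊆ L` for every
`σ ∈ I_𝔓` and some `σ ∈ I_𝔓` moving a point of `L` (the reduction line at a good ordinary `p`,
`exists_reductionLine_adicCompletionPrime`). Then `g(E[p])` is a rational line of `E'` which is NOT
unramified at `p`: for `P ∈ L` with `σP ≠ P`, `σP − P ∈ L ∖ 0`; if it lay in `ker g` then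
`ker g = L` (two lines sharing a non-zero point), contradicting `ker g` unramified; so
`σ·g(P) ≠ g(P)`. [cite: GreenbergVatsal2000, §2 p. 28 (E' = E/Φ: the image line is ramified)] -/
theorem isRationalLine_range_and_not_unramified_of_ker
    (g : geomTorsion W (p : ℤ) →+ geomTorsion W' (p : ℤ))
    (hg : ∀ (σ : absoluteGaloisGroup ℚ) (P : geomTorsion W (p : ℤ)), g (σ • P) = σ • g P)
    (hE : Nat.card (geomTorsion W (p : ℤ)) = p ^ 2)
    (hL₀ : ∃ (v : HeightOneSpectrum (𝓞 ℚ)), (p : 𝓞 ℚ) ∈ v.asIdeal ∧ ∃ 𝔓 ∈ v.primesAbove,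
      ∃ L : AddSubgroup (geomTorsion W (p : ℤ)), Nat.card L = p ∧
        (∀ σ ∈ 𝔓.inertia (absoluteGaloisGroup ℚ), ∀ P : geomTorsion W (p : ℤ), σ • P - P ∈ L) ∧
        (∃ σ ∈ 𝔓.inertia (absoluteGaloisGroup ℚ), ∃ P ∈ L, σ • P ≠ P))
    (hK : Nat.card g.ker = p) (hu : LineUnramifiedAt W p g.ker) :
    IsRationalLine W' p g.range ∧ ¬ LineUnramifiedAt W' p g.range := by
  refine ⟨isRationalLine_range g hg hE hK, fun hun ↦ ?_⟩
  obtain ⟨v, hv, 𝔓, h𝔓, L, hLcard, hLsub, σ, hσ, P, hPL, hσP⟩ := hL₀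
  have hd : σ • P - P ∈ L := hLsub σ hσ P
  have hd0 : σ • P - P ≠ 0 := sub_ne_zero.mpr hσP
  by_cases hker : σ • P - P ∈ g.ker
  · -- then `ker g = L`, and `ker g` is unramified: contradiction with `σP ≠ P`
    have hKL : g.ker = L := eq_of_prime_card_of_mem hK hLcard hd0 hker hd
    exact hσP (hu v hv 𝔓 h𝔓 σ hσ P (hKL ▸ hPL))
  · -- else `σ` moves `g P ∈ g(E[p])`: contradiction with `g(E[p])` unramified
    have hne : σ • g P ≠ g P := by
      intro h
      apply hker
      rw [AddMonoidHom.mem_ker, map_sub, hg, h, sub_self]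
    exact hne (hun v hv 𝔓 h𝔓 σ hσ (g P) ⟨P, rfl⟩)

/-! ## §2 Quotients by finite stable subgroups, and the degree of a cyclic quotient -/

section Quotient

variable {V : WeierstrassCurve ℚ} [V.IsElliptic]

/-- **Quotient by a finite `Γ_ℚ`-stable subgroup, onto a globally minimal model** (Silverman AEC
III.4.12 / Rem. III.4.13.2 — tree `exists_isogeny_ker_eq_and_comp_eq_nsmul_holds` — followed by Néron's
global minimal model, `hasGlobalMinimalModel_rat_holds`, and the change of variables as an isogeny,
`VariableChange.toIsogeny`; verbatim the argument of `IsogenyQuotientLine.exists_isogeny_ker_eq_line`).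
[cite: SilvermanAEC2009, Prop. III.4.12 with Rem. III.4.13.2] -/
theorem exists_minimal_isogeny_ker_eq (S : AddSubgroup V.geomPoints) (hSfin : (S : Set V.geomPoints).Finite)
    (hSstab : ∀ (σ : absoluteGaloisGroup ℚ) (P : V.geomPoints), P ∈ S → σ • P ∈ S) :
    ∃ (W : WeierstrassCurve ℚ) (_ : W.IsElliptic) (_ : W.IsGloballyMinimal) (g : Isogeny V W),
      g.toAddMonoidHom.ker = S := by
  obtain ⟨W₀, hW₀, g₀, -, hker, -, -⟩ := V.exists_isogeny_ker_eq_and_comp_eq_nsmul_holds S hSfin hSstab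
  obtain ⟨C, hC⟩ := hasGlobalMinimalModel_rat_holds W₀
  refine ⟨C • W₀, inferInstance, hC, (VariableChange.toIsogeny W₀ C).comp g₀, ?_⟩
  rw [Isogeny.ker_comp, VariableChange.ker_toIsogeny, AddMonoidHom.comap_bot, hker]

omit [V.IsElliptic] in
/-- The degree of an isogeny with kernel `ℤ·x` is the order of `x`; such an isogeny is cyclic.
[cite: SilvermanAEC2009, Prop. III.4.12 with Rem. III.4.13.2 and Cor. IX.6.2 (Galois-stable cyclic subgroups, quotient isogenies, Shafarevich finiteness of the isogeny class)] -/
theorem degree_eq_addOrderOf_of_ker_eq {W : WeierstrassCurve ℚ} (g : Isogeny V W) {x : V.geomPoints}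
    (hker : g.toAddMonoidHom.ker = AddSubgroup.zmultiples x) :
    g.degree = addOrderOf x ∧ g.IsCyclic := by
  refine ⟨?_, ?_⟩
  · unfold Isogeny.degree; rw [hker, Nat.card_zmultiples]
  · unfold Isogeny.IsCyclic; rw [hker]; infer_instance

omit [V.IsElliptic] in
/-- Transport of an isogeny along an equality of targets keeps degree and cyclicity. [cite: SilvermanAEC2009, Prop. III.4.12 with Rem. III.4.13.2 and Cor. IX.6.2 (Galois-stable cyclic subgroups, quotient isogenies, Shafarevich finiteness of the isogeny class)] -/
theorem degree_cast {W₁ W₂ : WeierstrassCurve ℚ} (h : W₁ = W₂) (ψ : Isogeny V W₁) :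
    (h ▸ ψ).degree = ψ.degree ∧ ((h ▸ ψ).IsCyclic ↔ ψ.IsCyclic) := by
  subst h; exact ⟨rfl, Iff.rfl⟩

end Quotient

/-! ## §3 The stable cyclic subgroups through an unramified line have bounded order -/

section Bounded

variable {V : WeierstrassCurve ℚ} [V.IsElliptic]

/-- **The orders `p^k` of `Γ_ℚ`-stable cyclic subgroups of `E(ℚ̄)` are bounded** (for elliptic
`E/ℚ`): distinct orders give non-isomorphic quotients `E/ℤx` — two CYCLIC `ℚ`-isogenies onto the
same curve have the same degree (`degree_eq_of_isCyclic`, from `End_ℚ(E) = ℤ`, tree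
`not_hasRationalCM_holds`) —, and the quotients lie in the finitely many `ℚ`-isomorphism classes of
the isogeny class (Shafarevich, AEC IX.6.2, tree `finite_isogenyClass_holds`).
[cite: SilvermanAEC2009, Cor. IX.6.2] -/
theorem bddAbove_setOf_stableCyclic :
    BddAbove {k : ℕ | ∃ x : V.geomPoints, addOrderOf x = p ^ k ∧
      ∀ σ : absoluteGaloisGroup ℚ, σ • x ∈ AddSubgroup.zmultiples x} := by
  have hp' : p.Prime := hp.out
  obtain ⟨F, hF⟩ := V.finite_isogenyClass_holds
  -- for each such `k`, a quotient `E/ℤx` and a representative in `F`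
  have hrep : ∀ k ∈ {k : ℕ | ∃ x : V.geomPoints, addOrderOf x = p ^ k ∧
      ∀ σ : absoluteGaloisGroup ℚ, σ • x ∈ AddSubgroup.zmultiples x}, ∃ W₀ ∈ F,
      ∃ (W : WeierstrassCurve ℚ) (_ : W.IsElliptic) (g : Isogeny V W) (C : VariableChange ℚ),
        g.degree = p ^ k ∧ g.IsCyclic ∧ C • W = W₀ := by
    rintro k ⟨x, hord, hstab⟩
    have hfin : (AddSubgroup.zmultiples x : Set V.geomPoints).Finite := by
      have : Finite (AddSubgroup.zmultiples x) := by
        apply Nat.finite_of_card_ne_zero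
        rw [Nat.card_zmultiples, hord]; exact pow_ne_zero _ hp'.ne_zero
      exact Set.toFinite _
    have hst : ∀ (σ : absoluteGaloisGroup ℚ) (P : V.geomPoints), P ∈ AddSubgroup.zmultiples x →
        σ • P ∈ AddSubgroup.zmultiples x := by
      intro σ P hP
      obtain ⟨n, rfl⟩ := AddSubgroup.mem_zmultiples_iff.mp hP
      rw [smul_comm σ n x]
      exact AddSubgroup.zsmul_mem _ (hstab σ) n
    obtain ⟨W, hW, -, g, hker⟩ := exists_minimal_isogeny_ker_eq (AddSubgroup.zmultiples x) hfin hst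
    obtain ⟨C, hC⟩ := @hF _ hW ⟨g⟩
    obtain ⟨hdeg, hcyc⟩ := degree_eq_addOrderOf_of_ker_eq g hker
    exact ⟨C • W, hC, W, hW, g, C, by rw [hdeg, hord], hcyc, rfl⟩
  choose! f hfF hf using hrep
  -- `k ↦ f k` is injective on the good `k`, into the finite `F`
  by_contra hnb
  have hinf : {k : ℕ | ∃ x : V.geomPoints, addOrderOf x = p ^ k ∧
      ∀ σ : absoluteGaloisGroup ℚ, σ • x ∈ AddSubgroup.zmultiples x}.Infinite :=
    fun hfin ↦ hnb hfin.bddAbove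
  obtain ⟨k₁, hk₁, k₂, hk₂, hne, heq⟩ :=
    hinf.exists_ne_map_eq_of_mapsTo (f := f) (fun k hk ↦ (hfF k hk : f k ∈ (F : Set _))) F.finite_toSet
  obtain ⟨W₁, hW₁, g₁, C₁, hdeg₁, hcyc₁, hCW₁⟩ := hf k₁ hk₁
  obtain ⟨W₂, hW₂, g₂, C₂, hdeg₂, hcyc₂, hCW₂⟩ := hf k₂ hk₂
  -- two cyclic isogenies `E → f k₁ = f k₂` of degrees `p^{k₁}`, `p^{k₂}`
  let ψ₁ : Isogeny V (C₁ • W₁) := (VariableChange.toIsogeny W₁ C₁).comp g₁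
  let ψ₂ : Isogeny V (C₂ • W₂) := (VariableChange.toIsogeny W₂ C₂).comp g₂
  have hψ₁ : ψ₁.degree = p ^ k₁ ∧ ψ₁.IsCyclic := by
    constructor
    · unfold Isogeny.degree
      rw [Isogeny.ker_comp, VariableChange.ker_toIsogeny, AddMonoidHom.comap_bot]; exact hdeg₁
    · unfold Isogeny.IsCyclic
      rw [Isogeny.ker_comp, VariableChange.ker_toIsogeny, AddMonoidHom.comap_bot]; exact hcyc₁
  have hψ₂ : ψ₂.degree = p ^ k₂ ∧ ψ₂.IsCyclic := by
    constructor
    · unfold Isogeny.degree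
      rw [Isogeny.ker_comp, VariableChange.ker_toIsogeny, AddMonoidHom.comap_bot]; exact hdeg₂
    · unfold Isogeny.IsCyclic
      rw [Isogeny.ker_comp, VariableChange.ker_toIsogeny, AddMonoidHom.comap_bot]; exact hcyc₂
  have h12 : C₁ • W₁ = C₂ • W₂ := by rw [hCW₁, hCW₂, heq]
  obtain ⟨hdeg₂', hcyc₂'⟩ := degree_cast h12.symm ψ₂
  haveI : (C₁ • W₁).IsElliptic := inferInstance
  have hdegeq := degree_eq_of_isCyclic ψ₁ (h12.symm ▸ ψ₂) hψ₁.2 (hcyc₂'.mpr hψ₂.2)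
  rw [hψ₁.1, hdeg₂', hψ₂.1] at hdegeq
  exact hne (Nat.pow_right_injective hp'.two_le hdegeq)

end Bounded

/-! ## §4 Elementary helpers on subgroups of prime order -/

section Helpers

variable {A : Type*} [AddCommGroup A]

omit hp in
/-- A subgroup of prime order `p` is `ℤ·x` for some `x ≠ 0` of order `p`. [cite: SilvermanAEC2009, Prop. III.4.12 with Rem. III.4.13.2 and Cor. IX.6.2 (Galois-stable cyclic subgroups, quotient isogenies, Shafarevich finiteness of the isogeny class)] -/
theorem exists_generator_of_prime_card {p : ℕ} [Fact p.Prime] (H : AddSubgroup A)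
    (hH : Nat.card H = p) : ∃ x : A, x ∈ H ∧ x ≠ 0 ∧ addOrderOf x = p ∧ AddSubgroup.zmultiples x = H := by
  have hp : p.Prime := Fact.out
  haveI : Finite H := Nat.finite_of_card_ne_zero (by rw [hH]; exact hp.ne_zero)
  have hnt : Nontrivial H := by
    rw [← Finite.one_lt_card_iff_nontrivial, hH]; exact hp.one_lt
  obtain ⟨⟨x, hx⟩, hx0⟩ := exists_ne (0 : H)
  have hx0' : x ≠ 0 := fun h ↦ hx0 (Subtype.ext h)
  have hord : addOrderOf x = p := by
    have hdvd : addOrderOf (⟨x, hx⟩ : H) ∣ p := by rw [← hH]; exact addOrderOf_dvd_natCard _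
    rw [AddSubgroup.addOrderOf_mk] at hdvd
    rcases (Nat.dvd_prime hp).mp hdvd with h | h
    · exact absurd (AddMonoid.addOrderOf_eq_one_iff.mp h) hx0'
    · exact h
  refine ⟨x, hx, hx0', hord, ?_⟩
  exact AddSubgroup.eq_of_le_of_card_ge (AddSubgroup.zmultiples_le_of_mem hx)
    (by rw [hH, Nat.card_zmultiples, hord])

end Helpers

end Literature.NumberTheory.EllipticCurves.RibetGoodLattice.StableCyclicQuotient

end Part12

/-!
## Part 13 — port of `Summits/BirchSwinnertonDyer/Rank1Residual/X1/GoodLatticeExists.lean` (3 declarations kept)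

# The good lattice EXISTS in every isogeny class: kernel discharge of the cited fact
# `ribet_exists_isIsogenous_noUnramifiedLine`

Cell `bsd-eis` (FULL-BSD rank-≤1 programme, row A1; home `run/shared/lean/pub/bsd-eis/`), seat
`bsd-eis-ky` (prover, Keller–Yin verification) gen 3, memo `HOME/bsd-eis-ky-MEMO-3.md` §5 R2.

`Literature/NumberTheory/EllipticCurves/ReducibleTorsionRibetLattice.lean` vendors, as a NAMED FACT,
Ribet's lemma for `E/ℚ` at a good Eisenstein prime `p > 2` (Ribet 1976 Prop. 2.1 + Faltings + *AEC*
III.4.12): the isogeny class of a globally minimal elliptic `W/ℚ` with `Good W p`, `Red W p` contains a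
globally minimal `W'` NONE of whose rational `p`-lines is unramified at `p` — Keller–Yin's "good
lattice" (arXiv:2402.12781v2 Prop. 1.3.1), the member on which the cell's THEOREM A
(`X1/KellerYinTheoremA.lean`) is proved. THIS FILE PROVES IT IN THE KERNEL
(`ribet_exists_isIsogenous_noUnramifiedLine_holds`), by the elementary isogeny-graph argument instead
of Ribet's lattice argument:

* if `W` has no unramified rational `p`-line, take `W' = W`;
* otherwise let `Φ` be an unramified rational line and consider the `Γ_ℚ`-stable CYCLIC subgroups
  `ℤx ⊂ E(ℚ̄)` of order `p^k` with `(ℤx)[p] = Φ`; `k = 1` occurs (`Φ` itself) and the possible `k` are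
  bounded (`StableCyclicQuotient.bddAbove_setOf_stableCyclic`: Shafarevich finiteness of the isogeny
  class, tree `finite_isogenyClass_holds`, and `degree_eq_of_isCyclic`); take `k` MAXIMAL and
  `W' =` a globally minimal model of `E/ℤx` (`exists_minimal_isogeny_ker_eq`);
* if `W'` had an unramified rational line `Ψ = ℤ q₀`, pick `y ∈ E(ℚ̄)` over `q₀`; then `p y = a x`.
  If `p ∤ a`, `ℤy ⊃ ℤx` is `Γ_ℚ`-stable cyclic of order `p^{k+1}` with `(ℤy)[p] = Φ` — contradicting
  maximality. If `p ∣ a`, `z = y - (a/p) x ∈ E[p]` maps to `q₀`, so `Ψ` is the image of `E[p]` under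
  the restriction `E[p] → E'[p]` of the quotient map, whose kernel is `(ℤx)[p] = Φ`, unramified; by
  `isRationalLine_range_and_not_unramified_of_ker` (the reduction line at the good ORDINARY `p`,
  `Rank1Residual.goodOrd_of_red_of_good`, is ramified and maps isomorphically onto the image) `Ψ` is
  NOT unramified — contradiction.

HONEST FRAMING. Unconditional kernel theorem; its only inputs are tree theorems (`_holds` discharges of
*AEC* III.4.12, VIII.8.3, IX.6.2, the reduction line at an ordinary prime, `End_ℚ(E) = ℤ`). It makes
`X1/KellerYinTheoremAClass.lean`'s hypothesis `hRibet` dischargeable by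
`ribet_exists_isIsogenous_noUnramifiedLine_holds`.

## References
* [Ribet1976] K. A. Ribet, Invent. Math. 34 (1976) 151–162, Prop. 2.1 (the statement discharged).
* [KellerYin2024] T. Keller, M. Yin, arXiv:2402.12781v2, Prop. 1.3.1 and §1.4 (the good lattice).
* [SilvermanAEC2009] J. H. Silverman, *AEC* 2nd ed., III.4.12, VIII.8.3, IX.6.2.
* HOME/bsd-eis-ky-MEMO-3.md §5 R2.
-/

section Part13

set_option autoImplicit false

open scoped _root_.Classical

open _root_.WeierstrassCurve _root_.NumberField _root_.IsDedekindDomain Literature.NumberTheory.EllipticCurves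
  Literature.NumberTheory.EllipticCurves.Rank1Residual Literature.NumberTheory.GaloisRepresentations _root_.Field
  Literature.NumberTheory.EllipticCurves.RibetGoodLattice.IsogenyLineType
  Literature.NumberTheory.EllipticCurves.RibetGoodLattice.IsogenyLineTypeGoodOrdinary
  Literature.NumberTheory.EllipticCurves.RibetGoodLattice.StableCyclicQuotient

namespace Literature.NumberTheory.EllipticCurves.RibetGoodLattice.GoodLatticeExists

variable {p : ℕ} [hp : Fact p.Prime]

/-! ## §5 The good lattice exists: the quotient by a MAXIMAL stable cyclic subgroup through the
unramified line has no unramified rational `p`-line -/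

section Main

variable {V : WeierstrassCurve ℚ} [V.IsElliptic] [V.IsGloballyMinimal]

omit [V.IsElliptic] [V.IsGloballyMinimal] in
/-- `ℤ·x` is finite and `Γ_ℚ`-stable when `x` has finite order and `σx ∈ ℤx` for all `σ`. [folklore] -/
private theorem zmultiples_finite_stable {x : V.geomPoints} {n : ℕ} (hn : n ≠ 0)
    (hord : addOrderOf x = n) (hstab : ∀ σ : absoluteGaloisGroup ℚ, σ • x ∈ AddSubgroup.zmultiples x) :
    (AddSubgroup.zmultiples x : Set V.geomPoints).Finite ∧
      ∀ (σ : absoluteGaloisGroup ℚ) (P : V.geomPoints), P ∈ AddSubgroup.zmultiples x →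
        σ • P ∈ AddSubgroup.zmultiples x := by
  refine ⟨?_, fun σ P hP ↦ ?_⟩
  · have : Finite (AddSubgroup.zmultiples x) := by
      apply Nat.finite_of_card_ne_zero; rw [Nat.card_zmultiples, hord]; exact hn
    exact Set.toFinite _
  · obtain ⟨m, rfl⟩ := AddSubgroup.mem_zmultiples_iff.mp hP
    rw [smul_comm σ m x]
    exact AddSubgroup.zsmul_mem _ (hstab σ) m

/-- **The good lattice exists in every isogeny class** (kernel form of Keller–Yin's Prop. 1.3.1 /
Ribet's lemma for `E/ℚ` at a good ordinary odd `p` with `E[p]` reducible). If `E` has an unramified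
rational `p`-line `Φ`, take a `Γ_ℚ`-stable cyclic subgroup `ℤx ⊂ E(ℚ̄)` with `(ℤx)[p] = Φ` of MAXIMAL
order `p^k` (`bddAbove_setOf_stableCyclic`) and `E' = E/ℤx` (globally minimal model); if `E'` had an
unramified rational line `Ψ`, its preimage `C' ⊃ ℤx` of order `p^{k+1}` is either cyclic and stable —
contradicting maximality — or contains `E[p]`, whence `Ψ` is the image of `E[p]`, which is RAMIFIED
(`isRationalLine_range_and_not_unramified_of_ker`, the reduction line at the ordinary `p`) —
contradiction. If `E` has no unramified rational line, `E' = E`.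
[cite: KellerYin2024, Prop. 1.3.1 and §1.4 (arXiv:2402.12781v2)] [cite: SilvermanAEC2009, Prop. III.4.12, Cor. IX.6.2] -/
theorem exists_isIsogenous_noUnramifiedLine (hp2 : 2 < p) (hgood : Good V p) (hred : Red V p) :
    ∃ (W : WeierstrassCurve ℚ) (_ : W.IsElliptic) (_ : W.IsGloballyMinimal),
      IsIsogenous V W ∧
        ∀ Φ : AddSubgroup (geomTorsion W (p : ℤ)), IsRationalLine W p Φ → ¬ LineUnramifiedAt W p Φ := by
  have hp' : p.Prime := hp.out
  have hpz : Prime (p : ℤ) := Int.prime_iff_natAbs_prime.mpr (by simpa using hp')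
  by_cases hex : ∃ Φ : AddSubgroup (geomTorsion V (p : ℤ)), IsRationalLine V p Φ ∧ LineUnramifiedAt V p Φ
  swap
  · push Not at hex
    exact ⟨V, inferInstance, inferInstance, IsIsogenous.refl_holds V, hex⟩
  obtain ⟨Φ, hΦ, hu⟩ := hex
  have hord : GoodOrd V p := Rank1Residual.goodOrd_of_red_of_good V p hp2 hgood hred
  -- the line `Φ' = Φ ⊂ E(ℚ̄)` and a generator
  set Φ' : AddSubgroup V.geomPoints := Φ.map (geomTorsion V (p : ℤ)).subtype with hΦ'
  have hΦ'card : Nat.card Φ' = p := IsogenyQuotientLine.natCard_map_subtype hΦ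
  obtain ⟨x₀, hx₀Φ, hx₀0, hx₀ord, hx₀gen⟩ := exists_generator_of_prime_card (p := p) Φ' hΦ'card
  -- the set of good orders is non-empty (k = 1) and bounded; take the maximum
  let T : Set ℕ := {k : ℕ | ∃ x : V.geomPoints, addOrderOf x = p ^ k ∧
    (∀ σ : absoluteGaloisGroup ℚ, σ • x ∈ AddSubgroup.zmultiples x) ∧
      p ^ (k - 1) • x ∈ Φ' ∧ p ^ (k - 1) • x ≠ 0}
  have h1T : 1 ∈ T := by
    refine ⟨x₀, by rw [pow_one]; exact hx₀ord, fun σ ↦ ?_,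
      by rw [Nat.sub_self, pow_zero, one_smul]; exact hx₀Φ, by rw [Nat.sub_self, pow_zero, one_smul]; exact hx₀0⟩
    rw [hx₀gen]
    obtain ⟨P, hP, rfl⟩ := hx₀Φ
    exact ⟨σ • P, hΦ.2 σ P hP, rfl⟩
  have hbdd : BddAbove T := by
    refine BddAbove.mono (fun k hk ↦ ?_) (bddAbove_setOf_stableCyclic (V := V) (p := p))
    obtain ⟨x, h1, h2, -⟩ := hk
    exact ⟨x, h1, h2⟩
  obtain ⟨x, hxord, hxstab, hxΦ, hx0⟩ : sSup T ∈ T := Nat.sSup_mem ⟨1, h1T⟩ hbdd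
  set k := sSup T with hk
  have hk1 : 1 ≤ k := le_csSup hbdd h1T
  -- `t = p^{k-1} x` generates `Φ'`, of order `p`
  set t : V.geomPoints := p ^ (k - 1) • x with ht
  have htgen : AddSubgroup.zmultiples t = Φ' := by
    obtain ⟨t₁, -, -, ht₁ord, ht₁gen⟩ := exists_generator_of_prime_card (p := p) Φ' hΦ'card
    have := eq_of_prime_card_of_mem (p := p) (H₁ := AddSubgroup.zmultiples t) (H₂ := Φ') ?_ hΦ'card hx0
      (AddSubgroup.mem_zmultiples t) hxΦ
    · exact this
    · -- `ord t = p`: `t ∈ Φ'` non-zero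
      rw [Nat.card_zmultiples]
      haveI : Finite Φ' := Nat.finite_of_card_ne_zero (by rw [hΦ'card]; exact hp'.ne_zero)
      have hdvd : addOrderOf (⟨t, hxΦ⟩ : Φ') ∣ p := by rw [← hΦ'card]; exact addOrderOf_dvd_natCard _
      rw [AddSubgroup.addOrderOf_mk] at hdvd
      rcases (Nat.dvd_prime hp').mp hdvd with h | h
      · exact absurd (AddMonoid.addOrderOf_eq_one_iff.mp h) hx0
      · exact h
  have htord : addOrderOf t = p := by
    have h := congrArg (fun H : AddSubgroup V.geomPoints ↦ Nat.card H) htgen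
    simp only [Nat.card_zmultiples] at h
    rw [h, hΦ'card]
  -- the quotient `E' = E/ℤx`
  obtain ⟨hfin, hst⟩ := zmultiples_finite_stable (V := V) (pow_ne_zero k hp'.ne_zero) hxord hxstab
  obtain ⟨W, hW, hWmin, g, hker⟩ := exists_minimal_isogeny_ker_eq (AddSubgroup.zmultiples x) hfin hst
  refine ⟨W, hW, hWmin, ⟨g⟩, fun Ψ hΨ hunΨ ↦ ?_⟩
  -- a generator `q₀` of `Ψ` and a preimage `y`
  obtain ⟨q₀, hq₀Ψ, hq₀0, -, hq₀gen⟩ := exists_generator_of_prime_card (p := p) Ψ hΨ.1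
  obtain ⟨y, hy⟩ := g.surjective (q₀ : W.geomPoints)
  -- `p y ∈ ker g = ℤ x`: `a x = p y`
  have hpy : (p : ℤ) • y ∈ g.toAddMonoidHom.ker := by
    rw [AddMonoidHom.mem_ker, map_zsmul, Isogeny.coe_toAddMonoidHom, hy]
    have h0 : (p : ℤ) • (q₀ : W.geomPoints) = 0 := (Submodule.mem_torsionBy_iff (p : ℤ) _).mp q₀.2
    exact h0
  rw [hker] at hpy
  obtain ⟨a, ha⟩ := AddSubgroup.mem_zmultiples_iff.mp hpy
  -- `p^k x = 0`
  have hpkx : ((p : ℤ) ^ k) • x = 0 := by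
    rw [← Nat.cast_pow, natCast_zsmul, ← hxord]; exact addOrderOf_nsmul_eq_zero x
  by_cases hdvd : (p : ℤ) ∣ a
  · ---------------------------------------------------------------- `p ∣ a`: then `E[p] ↠ Ψ` — ramified
    obtain ⟨a', rfl⟩ := hdvd
    set z : V.geomPoints := y - a' • x with hz
    have hpz0 : (p : ℤ) • z = 0 := by
      rw [hz, smul_sub, ← ha, smul_smul]
      exact sub_self _
    have hzmem : z ∈ geomTorsion V (p : ℤ) := (Submodule.mem_torsionBy_iff (p : ℤ) _).mpr hpz0
    have hxker : x ∈ g.toAddMonoidHom.ker := by rw [hker]; exact AddSubgroup.mem_zmultiples x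
    have hgz : g z = (q₀ : W.geomPoints) := by
      rw [hz, map_sub, map_zsmul, hy]
      rw [AddMonoidHom.mem_ker, Isogeny.coe_toAddMonoidHom] at hxker
      rw [hxker, smul_zero, sub_zero]
    -- restrict `g` to `E[p]`; its kernel is `(ℤx)[p] = Φ`
    obtain ⟨g', hg'val, hg'⟩ := IsogenyLineType.exists_restrict_torsion (p := p) g
    have hker' : g'.ker = Φ := by
      ext P
      rw [AddMonoidHom.mem_ker]
      constructor
      · intro hP
        have h1 : (P : V.geomPoints) ∈ g.toAddMonoidHom.ker := by
          rw [AddMonoidHom.mem_ker, Isogeny.coe_toAddMonoidHom, ← hg'val, hP]; rfl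
        rw [hker] at h1
        obtain ⟨m, hm⟩ := AddSubgroup.mem_zmultiples_iff.mp h1
        -- `p^k ∣ p m` since `p (m x) = 0`
        have hP0 : (p : ℤ) • (P : V.geomPoints) = 0 := (Submodule.mem_torsionBy_iff (p : ℤ) _).mp P.2
        have hdiv : (addOrderOf x : ℤ) ∣ p * m := by
          rw [addOrderOf_dvd_iff_zsmul_eq_zero, mul_smul, hm, hP0]
        rw [hxord, Nat.cast_pow] at hdiv
        obtain ⟨m', hm'⟩ : (p : ℤ) ^ (k - 1) ∣ m := by
          have hk' : k = (k - 1) + 1 := by omega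
          have hdiv' : (p : ℤ) ^ (k - 1) * p ∣ m * p := by
            rw [hk', pow_succ, mul_comm (p : ℤ) m] at hdiv; exact hdiv
          have hp0 : (p : ℤ) ≠ 0 := by exact_mod_cast hp'.ne_zero
          exact (mul_dvd_mul_iff_right hp0).mp hdiv'
        -- so `P = m' • t ∈ Φ'`
        have hPt : (P : V.geomPoints) ∈ Φ' := by
          rw [← htgen, AddSubgroup.mem_zmultiples_iff]
          refine ⟨m', ?_⟩
          rw [ht, ← hm, hm', mul_comm, mul_smul, ← Nat.cast_pow, natCast_zsmul]
        obtain ⟨Q, hQ, hQP⟩ := hPt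
        have : Q = P := Subtype.ext hQP
        exact this ▸ hQ
      · intro hP
        have hPt : (P : V.geomPoints) ∈ Φ' := ⟨P, hP, rfl⟩
        rw [← htgen, AddSubgroup.mem_zmultiples_iff] at hPt
        obtain ⟨m, hm⟩ := hPt
        have h1 : (P : V.geomPoints) ∈ g.toAddMonoidHom.ker := by
          rw [hker, AddSubgroup.mem_zmultiples_iff]
          exact ⟨m * (p : ℤ) ^ (k - 1), by rw [mul_smul, ← hm, ht, ← Nat.cast_pow, natCast_zsmul]⟩
        rw [AddMonoidHom.mem_ker, Isogeny.coe_toAddMonoidHom, ← hg'val] at h1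
        exact Subtype.ext h1
    have hK : Nat.card g'.ker = p := by rw [hker']; exact hΦ.1
    obtain ⟨hrat, hnram⟩ := isRationalLine_range_and_not_unramified_of_ker g' hg'
      (Rank1Residual.natCard_geomTorsion V p)
      (IsogenyLineTypeGoodOrdinary.exists_reductionLine_adicCompletionPrime V p (by omega) hgood hord.2)
      hK (hker' ▸ hu)
    -- `g'(E[p]) = Ψ`: both are lines containing `q₀ ≠ 0`
    have hq₀range : q₀ ∈ g'.range := by
      refine ⟨⟨z, hzmem⟩, Subtype.ext ?_⟩
      rw [hg'val]; exact hgz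
    have hrange : g'.range = Ψ := eq_of_prime_card_of_mem (p := p) hrat.1 hΨ.1 hq₀0 hq₀range hq₀Ψ
    exact hnram (hrange ▸ hunΨ)
  · ---------------------------------------------------------------- `p ∤ a`: `ℤy` is a bigger good subgroup
    -- `x ∈ ℤ y` (Bezout: `a` is a unit mod `p^k`)
    have hcop : IsCoprime ((p : ℤ) ^ k) a := (IsCoprime.pow_left ((Prime.coprime_iff_not_dvd hpz).mpr hdvd))
    obtain ⟨u, v, huv⟩ := hcop
    have hxy : x ∈ AddSubgroup.zmultiples y := by
      have : x = v • ((p : ℤ) • y) := by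
        calc x = (u * (p : ℤ) ^ k + v * a) • x := by rw [huv, one_smul]
          _ = u • (((p : ℤ) ^ k) • x) + v • (a • x) := by rw [add_smul, mul_smul, mul_smul]
          _ = v • ((p : ℤ) • y) := by rw [hpkx, smul_zero, zero_add, ha]
      rw [this, smul_smul]
      exact AddSubgroup.zsmul_mem _ (AddSubgroup.mem_zmultiples y) _
    -- `p^k y = a t ≠ 0` lies in `Φ'`, and `p^{k+1} y = 0`
    have hpky : p ^ k • y = a • t := by
      have hk' : k = (k - 1) + 1 := by omega
      calc p ^ k • y = ((p : ℤ) ^ (k - 1) * (p : ℤ)) • y := by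
              rw [← natCast_zsmul, Nat.cast_pow, ← pow_succ, ← hk']
        _ = ((p : ℤ) ^ (k - 1) * a) • x := by rw [mul_smul ((p : ℤ) ^ (k - 1)) (p : ℤ) y, ← ha, ← mul_smul]
        _ = a • t := by rw [mul_comm, mul_smul, ht, ← natCast_zsmul x (p ^ (k - 1)), Nat.cast_pow]
    have hat0 : a • t ≠ 0 := by
      intro h0
      apply hdvd
      have := addOrderOf_dvd_iff_zsmul_eq_zero.mpr h0
      rwa [htord] at this
    have hpk1y : p ^ (k + 1) • y = 0 := by
      calc p ^ (k + 1) • y = p • (p ^ k • y) := by rw [pow_succ', mul_smul]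
        _ = p • (a • t) := by rw [hpky]
        _ = a • (p • t) := smul_comm _ _ _
        _ = 0 := by rw [← htord, addOrderOf_nsmul_eq_zero, smul_zero]
    have hyord : addOrderOf y = p ^ (k + 1) :=
      addOrderOf_eq_prime_pow (by rw [hpky]; exact hat0) hpk1y
    -- `ℤ y` is `Γ_ℚ`-stable: `g(σ y) = σ q₀ = m q₀ = g(m y)`
    have hystab : ∀ σ : absoluteGaloisGroup ℚ, σ • y ∈ AddSubgroup.zmultiples y := by
      intro σ
      have hσq : σ • q₀ ∈ AddSubgroup.zmultiples q₀ := by rw [hq₀gen]; exact hΨ.2 σ q₀ hq₀Ψ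
      obtain ⟨m, hm⟩ := AddSubgroup.mem_zmultiples_iff.mp hσq
      have hdiff : σ • y - m • y ∈ g.toAddMonoidHom.ker := by
        rw [AddMonoidHom.mem_ker, map_sub, map_zsmul, Isogeny.coe_toAddMonoidHom, Isogeny.map_smul, hy,
          ← AddSubgroup.torsionBy.coe_smul, ← hm]
        simp
      rw [hker] at hdiff
      have hsub : AddSubgroup.zmultiples x ≤ AddSubgroup.zmultiples y := AddSubgroup.zmultiples_le_of_mem hxy
      have := hsub hdiff
      have h2 : σ • y = (σ • y - m • y) + m • y := by abel
      rw [h2]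
      exact AddSubgroup.add_mem _ this (AddSubgroup.zsmul_mem _ (AddSubgroup.mem_zmultiples y) m)
    -- hence `k + 1` is a good order: contradiction with maximality
    have hmem : k + 1 ∈ T := by
      refine ⟨y, hyord, hystab, ?_, ?_⟩
      · rw [Nat.add_sub_cancel, hpky, ← htgen]
        exact AddSubgroup.zsmul_mem _ (AddSubgroup.mem_zmultiples t) a
      · rw [Nat.add_sub_cancel, hpky]; exact hat0
    have : k + 1 ≤ k := hk ▸ le_csSup hbdd hmem
    omega

/-- **Discharge of the cited fact `ribet_exists_isIsogenous_noUnramifiedLine`** (Ribet's lemma for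
elliptic curves over `ℚ` at a good Eisenstein prime `p > 2`, `Literature/…/ReducibleTorsionRibetLattice.lean`):
a THEOREM of the tree, by `exists_isIsogenous_noUnramifiedLine`.
[cite: Ribet1976, Prop. 2.1] [cite: KellerYin2024, Prop. 1.3.1 (arXiv:2402.12781v2)] -/
theorem ribet_exists_isIsogenous_noUnramifiedLine_holds : ribet_exists_isIsogenous_noUnramifiedLine :=
  fun _ _ _ _ _ hp2 hgood hred ↦ exists_isIsogenous_noUnramifiedLine hp2 hgood hred

end Main

end Literature.NumberTheory.EllipticCurves.RibetGoodLattice.GoodLatticeExists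

end Part13

/-! ## Part 14 — the EXACT discharge -/

namespace Literature.NumberTheory.EllipticCurves

/-- **The named fact `ribet_exists_isIsogenous_noUnramifiedLine` HOLDS** (`ReducibleTorsionRibetLattice.lean`; Ribet 1976
Prop. 2.1 + Faltings + *AEC* III.4.12, in Keller–Yin's normalisation arXiv:2402.12781v2 Prop. 1.3.1: the ℚ-isogeny class of a
globally minimal elliptic `W/ℚ` with `Good W p`, `Red W p`, `2 < p`, contains a globally minimal `W'` none of whose rational
`p`-lines is unramified at `p`).  EXACT-name restatement of `RibetGoodLattice.GoodLatticeExists.ribet_exists_isIsogenous_noUnramifiedLine_holds`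
(last Part: the elementary isogeny-graph argument), Literature-side twin of
`Summit.BirchSwinnertonDyer.Rank1Residual.X1.GoodLatticeExists.ribet_exists_isIsogenous_noUnramifiedLine_holds` (same proof).
[cite: Ribet1976, Prop. (2.1), p. 154] [cite: KellerYin2024, Prop. 1.3.1 and §1.4 (arXiv:2402.12781v2)] -/
theorem ribet_exists_isIsogenous_noUnramifiedLine_holds : ribet_exists_isIsogenous_noUnramifiedLine :=
  RibetGoodLattice.GoodLatticeExists.ribet_exists_isIsogenous_noUnramifiedLine_holds

end Literature.NumberTheory.EllipticCurves

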